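import Literature.Probability.LatticeModels.MixingBoxEventually
import Literature.Probability.LatticeModels.MixingErrorTerms
import Literature.Probability.LatticeModels.MixingBoxGrid
import Literature.Probability.LatticeModels.MixingScales
import Literature.Probability.LatticeModels.IntersectionClusteringBound
import HarnessLib

/-!
# (6.9) between regular far sources on the boxes `Λ_L ↑ ℤ⁴` (Aizenman–Duminil-Copin 2021, §6.2, "(eq:od)")

Topic `Literature/Probability/LatticeModels`. Theorems only; **no named fact is introduced** (D-0026).

M. Aizenman, H. Duminil-Copin, Ann. of Math. **194** (2021) = arXiv:1912.07973, §6.2, proof of Theorem 6.4,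
p. 25–26: "We begin by proving (6.9) when all the `y_i, y'_i` for `i ≤ t` belong to regular scales (not
necessarily the same ones). In this case, apply twice (once for `𝐲` and once for `𝐲'`) the previous inequality
[(6.16)] for our event `E` and the event on the outside being the full event to find
`|P^{𝐱𝐲}[E] - P^{𝐱𝐲'}[E]| ≤ |∑_𝐮 (δ(𝐮,𝐱,𝐲) - δ(𝐮,𝐱,𝐲')) P^{𝐱𝐮}[E]| + 2C₇s/√log(N/n)`. Since all the `y_i,y'_i`
are in regular scales, … `𝔸_{y_i}(2^{k_i}) = 𝔸_{y'_i}(2^{k_i})` … Property 2 of regular scales implies that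
`|δ(𝐮,𝐱,𝐲) - δ(𝐮,𝐱,𝐲')| ≤ C₈s(M/N)δ(𝐮,𝐱,𝐲)`. Therefore, (6.9) follows readily".

This file proves that statement on `Λ_L` for all large `L`, for `t = 2` and centre sources `x₁ = x₂ = u`
(`Current.box_relocation_regular`): (6.16) on `Λ_L` with the full outside event (`MixingBoxEventually`, index
sets `regFamily`, the same for all regular far sources), the factorisation and closeness of the switch weights
(`MixingBoxSwitchWeights`: both `δ(·,𝐲)` and `δ(·,𝐲')` are within a factor of the reference weights `δ'`), and the
weighted-average algebra of `RandomCurrentsMixingEndgame`. The error is explicit: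
`2(ε_conc + ε_split + ((1+ζ)⁴/(1-η)⁴ - 1))`, `ζ = 4C M₃/2^{k_f}` the P2-distortion.

* `Current.box_mixingCore_prob_eventually'` — (6.16) restated with the abbreviations `concErr`, `splitErr` of
  `MixingErrorTerms`;
* `Current.switchWeight_ne_zero_imp` — the support of the switch weights lies in the blocks;
* `Current.box_relocation_regular` — **(6.9), regular case, on `Λ_L` eventually**.

## References

* M. Aizenman, H. Duminil-Copin, Ann. of Math. 194 (2021), arXiv:1912.07973, §6.2, proof of Thm 6.4, derivation of
  (6.9) in the regular case (pp. 25–26) [AizenmanDuminilCopinAnnals2021].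
-/

noncomputable section

open Finset Filter
open scoped symmDiff ENNReal

namespace Literature.Probability.LatticeModels

namespace Current

/-- (6.16) on `Λ_L` for all large `L`, with the error written as `concErr + splitErr`. [cite: AizenmanDuminilCopinAnnals2021, arXiv:1912.07973 §6.2, (6.16) (p. 25)] -/
theorem box_mixingCore_prob_eventually' {β : ℝ} (hβ : 0 < β) (hβc : β ≤ criticalBeta 4) {CIR : ℝ} (hCIR : 0 ≤ CIR)
    (hIR : ∀ x : Site 4, x ≠ 0 → twoPointFree 4 β x ≤ CIR / (Site.supNorm x : ℝ) ^ 2)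
    (u y₁ y₂ : Site 4) (𝒦 : Finset ℕ) (I₁ I₂ : ℕ → Finset (Site 4))
    {c C κ Y γ η sW θ : ℝ} (hc : 0 < c) (hC : 0 ≤ C) (hκ : 0 ≤ κ) (hγ : 0 < γ) (hη0 : 0 < η) (hη1 : η < 1)
    (hsW : 0 < sW) (hθ : 0 ≤ θ)
    (h𝒦 : 𝒦.Nonempty) (hreg : ∀ j ∈ 𝒦, IsRegularScale (twoPointFree 4 β) c C (2 ^ j))
    (hsep : ∀ j ∈ 𝒦, ∀ j' ∈ 𝒦, j < j' → (C + 2) * 2 ^ j < (2 ^ j' : ℝ)) (hY : ∀ j ∈ 𝒦, (2 ^ j : ℝ) ≤ Y)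
    (hI₁ : ∀ j ∈ 𝒦, I₁ j ⊆ ann 4 (2 ^ j) (2 * 2 ^ j)) (hI₂ : ∀ j ∈ 𝒦, I₂ j ⊆ ann 4 (2 ^ j) (2 * 2 ^ j))
    (hcard₁ : ∀ j ∈ 𝒦, γ * (2 ^ j : ℝ) ^ 4 ≤ #(I₁ j)) (hcard₂ : ∀ j ∈ 𝒦, γ * (2 ^ j : ℝ) ^ 4 ≤ #(I₂ j))
    (hdom₁ : ∀ j ∈ 𝒦, ∀ v ∈ I₁ j, twoPointFree 4 β (y₁ - u) ≤ (1 + κ * 2 ^ j / Y) * twoPointFree 4 β (y₁ - u - v))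
    (hdom₂ : ∀ j ∈ 𝒦, ∀ v ∈ I₂ j, twoPointFree 4 β (y₂ - u) ≤ (1 + κ * 2 ^ j / Y) * twoPointFree 4 β (y₂ - u - v))
    {n₀ r mℓ m₀ M₃ R N₄ : ℕ} (hn₀ : 1 ≤ n₀) (hn₀r : n₀ < r) (hrmℓ : r < mℓ) (hrm : r ≤ m₀ + 1) (h12 : n₀ ≤ m₀)
    (h23 : m₀ ≤ M₃) (hMR : M₃ < R) (hRN : R ≤ N₄)
    (hmℓ𝒦 : ∀ j ∈ 𝒦, mℓ ≤ 2 ^ j) (hM𝒦 : ∀ j ∈ 𝒦, 2 * 2 ^ j ≤ M₃)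
    (hfar₁ : N₄ < Site.supNorm (y₁ - u)) (hfar₂ : N₄ < Site.supNorm (y₂ - u))
    (hdomθ₁ : ∀ j ∈ 𝒦, ∀ v ∈ I₁ j, ∀ p : Site 4, Site.supNorm p ≤ r →
      twoPointFree 4 β (y₁ - u - p) ≤ θ * twoPointFree 4 β (y₁ - u - v))
    (hdomθ₂ : ∀ j ∈ 𝒦, ∀ v ∈ I₂ j, ∀ p : Site 4, Site.supNorm p ≤ r →
      twoPointFree 4 β (y₂ - u - p) ≤ θ * twoPointFree 4 β (y₂ - u - v))
    (hsW₁ : ∀ j ∈ 𝒦, ∀ v ∈ I₁ j, sW ≤ twoPointFree 4 β v) (hsW₂ : ∀ j ∈ 𝒦, ∀ v ∈ I₂ j, sW ≤ twoPointFree 4 β v) :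
    ∀ᶠ L : ℕ in atTop, ∀ (hu : u ∈ box 4 L) (hy₁ : y₁ ∈ box 4 L) (hy₂ : y₂ ∈ box 4 L),
      ∀ Φ Ψ : FourCfg (boxGraph (box 4 L)) → ℝ≥0∞, (∀ pq, Φ pq ≤ 1) → (∀ pq, Ψ pq ≤ 1) →
        FourLocal (edgesWithin (G := boxGraph (box 4 L)) ⟨u, hu⟩ n₀) Φ →
        FourLocal (edgesBeyond (G := boxGraph (box 4 L)) ⟨u, hu⟩ (N₄ + 1)) Ψ →
        |srcProb (Kc (box 4 L) β) ({⟨u, hu⟩} ∆ {⟨y₁, hy₁⟩}) ({⟨u, hu⟩} ∆ {⟨y₂, hy₂⟩}) (Φ * Ψ) -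
          ∑ v₁, ∑ v₂, switchWeight (Kc (box 4 L) β) ⟨u, hu⟩ ⟨u, hu⟩ ⟨y₁, hy₁⟩ ⟨y₂, hy₂⟩
              (mixCoeff β ⟨u, hu⟩ ⟨y₁, hy₁⟩ 𝒦 I₁) (mixCoeff β ⟨u, hu⟩ ⟨y₂, hy₂⟩ 𝒦 I₂) v₁ v₂ *
            (srcProb (Kc (box 4 L) β) ({⟨u, hu⟩} ∆ {v₁}) ({⟨u, hu⟩} ∆ {v₂}) Φ *
              srcProb (Kc (box 4 L) β) ({v₁} ∆ {⟨y₁, hy₁⟩}) ({v₂} ∆ {⟨y₂, hy₂⟩}) Ψ)| ≤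
        concErr c C κ γ η #𝒦 + splitErr CIR η sW θ n₀ r mℓ m₀ M₃ R N₄ :=
  box_mixingCore_prob_eventually hβ hβc hCIR hIR u y₁ y₂ 𝒦 I₁ I₂ hc hC hκ hγ hη0 hη1 hsW hθ h𝒦 hreg hsep hY hI₁ hI₂ hcard₁
    hcard₂ hdom₁ hdom₂ hn₀ hn₀r hrmℓ hrm h12 h23 hMR hRN hmℓ𝒦 hM𝒦 hfar₁ hfar₂ hdomθ₁ hdomθ₂ hsW₁ hsW₂

/-! ### The support of the switch weights -/

variable {Λ : Finset (Site 4)} {β : ℝ}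

/-- **The switch weights vanish off the blocks**: `δ(v₁,v₂) ≠ 0` forces `vᵢ - u ∈ Iᵢ kᵢ` for some `kᵢ ∈ 𝒦`. [folklore] -/
theorem switchWeight_ne_zero_imp (u y₁ y₂ : ↥Λ) (𝒦 : Finset ℕ) (I₁ I₂ : ℕ → Finset (Site 4)) {v₁ v₂ : ↥Λ}
    (h : switchWeight (Kc Λ β) u u y₁ y₂ (mixCoeff β u y₁ 𝒦 I₁) (mixCoeff β u y₂ 𝒦 I₂) v₁ v₂ ≠ 0) :
    (∃ k ∈ 𝒦, ((v₁ : Site 4) - u) ∈ I₁ k) ∧ ∃ k ∈ 𝒦, ((v₂ : Site 4) - u) ∈ I₂ k := by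
  constructor
  · refine exists_mem_of_mixCoeff_ne_zero (β := β) u y₁ 𝒦 I₁ fun h0 => h ?_
    unfold switchWeight; rw [h0]; simp
  · refine exists_mem_of_mixCoeff_ne_zero (β := β) u y₂ 𝒦 I₂ fun h0 => h ?_
    unfold switchWeight; rw [h0]; simp

/-! ### (6.9) between regular far sources -/

set_option maxHeartbeats 1000000 in
open Classical in
/-- **(6.9), regular case, on `Λ_L` for all large `L`** (`t = 2`, centre sources `x₁ = x₂ = u`). Let
`0 < β ≤ β_c`, `S = S_β` with the Infrared Bound, and four far points `p₁, p₂, p₁', p₂'` with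
`pᵢ - u ∈ Ann(2^{kᵢ}, 2^{kᵢ+1})`, `kᵢ ≥ k_f` `(c,C)`-regular scales; lower data: a non-empty set `𝒦` of
`(c,C)`-regular separated scales with `4·2^j ≤ 2^{k_f}`, radii `1 ≤ n₀ < r < m_ℓ ≤ 2^j`, `2^{j+1} ≤ M₃`,
`r ≤ m₀+1`, `n₀ ≤ m₀ ≤ M₃ < R ≤ N₄ < 2^{k_f}`, `2r ≤ 2^{k_f}`, `2M₃ ≤ 2^{k_f}`, `S ≥ s_W > 0` on the blocks
`regFamily j`, and a loss `0 < η < 1`. Then for all large `L` and every `[0,1]`-valued `Φ` local inside `Λ_{n₀}(u)`: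
`|P^{up₁,up₂}_{Λ_L}[Φ] - P^{up₁',up₂'}_{Λ_L}[Φ]| ≤ odErr` (`= 2(ε_conc + ε_split + (1+ζ)⁴/(1-η)⁴ - 1)`, `ζ = 4CM₃/2^{k_f}`).
[cite: AizenmanDuminilCopinAnnals2021, arXiv:1912.07973 §6.2, proof of Thm 6.4, (6.9) in the regular case (pp. 25–26)] -/
theorem box_relocation_regular {β : ℝ} (hβ : 0 < β) (hβc : β ≤ criticalBeta 4) {CIR : ℝ} (hCIR : 0 ≤ CIR)
    (hIR : ∀ x : Site 4, x ≠ 0 → twoPointFree 4 β x ≤ CIR / (Site.supNorm x : ℝ) ^ 2)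
    (u p₁ p₂ p₁' p₂' : Site 4) {c C : ℝ} (hc : 0 < c) (hC : 0 ≤ C) {k₁ k₂ k₁' k₂' kf : ℕ}
    (hreg₁ : IsRegularScale (twoPointFree 4 β) c C (2 ^ k₁)) (hreg₂ : IsRegularScale (twoPointFree 4 β) c C (2 ^ k₂))
    (hreg₁' : IsRegularScale (twoPointFree 4 β) c C (2 ^ k₁')) (hreg₂' : IsRegularScale (twoPointFree 4 β) c C (2 ^ k₂'))
    (hp₁ : p₁ - u ∈ ann 4 (2 ^ k₁) (2 * 2 ^ k₁)) (hp₂ : p₂ - u ∈ ann 4 (2 ^ k₂) (2 * 2 ^ k₂))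
    (hp₁' : p₁' - u ∈ ann 4 (2 ^ k₁') (2 * 2 ^ k₁')) (hp₂' : p₂' - u ∈ ann 4 (2 ^ k₂') (2 * 2 ^ k₂'))
    (hkf₁ : kf ≤ k₁) (hkf₂ : kf ≤ k₂) (hkf₁' : kf ≤ k₁') (hkf₂' : kf ≤ k₂')
    (𝒦 : Finset ℕ) (h𝒦 : 𝒦.Nonempty) (hreg𝒦 : ∀ j ∈ 𝒦, IsRegularScale (twoPointFree 4 β) c C (2 ^ j))
    (hsep : ∀ j ∈ 𝒦, ∀ j' ∈ 𝒦, j < j' → (C + 2) * 2 ^ j < (2 ^ j' : ℝ)) (hj : ∀ j ∈ 𝒦, 4 * 2 ^ j ≤ 2 ^ kf)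
    {η sW : ℝ} (hη0 : 0 < η) (hη1 : η < 1) (hsW : 0 < sW) (hsW𝒦 : ∀ j ∈ 𝒦, ∀ v ∈ regFamily j, sW ≤ twoPointFree 4 β v)
    {n₀ r mℓ m₀ M₃ R N₄ : ℕ} (hn₀ : 1 ≤ n₀) (hn₀r : n₀ < r) (hrmℓ : r < mℓ) (hrm : r ≤ m₀ + 1) (h12 : n₀ ≤ m₀)
    (h23 : m₀ ≤ M₃) (hMR : M₃ < R) (hRN : R ≤ N₄)
    (hmℓ𝒦 : ∀ j ∈ 𝒦, mℓ ≤ 2 ^ j) (hM𝒦 : ∀ j ∈ 𝒦, 2 * 2 ^ j ≤ M₃)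
    (hr : 2 * r ≤ 2 ^ kf) (h2M : 2 * M₃ ≤ 2 ^ kf) (hN : N₄ < 2 ^ kf) :
    ∀ᶠ L : ℕ in atTop, ∀ (hu : u ∈ box 4 L) (hq₁ : p₁ ∈ box 4 L) (hq₂ : p₂ ∈ box 4 L) (hq₁' : p₁' ∈ box 4 L)
      (hq₂' : p₂' ∈ box 4 L), ∀ Φ : FourCfg (boxGraph (box 4 L)) → ℝ≥0∞, (∀ pq, Φ pq ≤ 1) →
        FourLocal (edgesWithin (G := boxGraph (box 4 L)) ⟨u, hu⟩ n₀) Φ →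
        |srcProb (Kc (box 4 L) β) ({⟨u, hu⟩} ∆ {⟨p₁, hq₁⟩}) ({⟨u, hu⟩} ∆ {⟨p₂, hq₂⟩}) Φ -
          srcProb (Kc (box 4 L) β) ({⟨u, hu⟩} ∆ {⟨p₁', hq₁'⟩}) ({⟨u, hu⟩} ∆ {⟨p₂', hq₂'⟩}) Φ| ≤
        odErr c C CIR η sW (4 * C * M₃ / 2 ^ kf) #𝒦 n₀ r mℓ m₀ M₃ R N₄ := by
  set S : Site 4 → ℝ := twoPointFree 4 β with hSdef
  have hSpos : ∀ z, 0 < S z := twoPointFree_pos_four hβ hβc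
  have hS0 : ∀ z, 0 ≤ S z := fun z => (hSpos z).le
  set ζ : ℝ := 4 * C * M₃ / 2 ^ kf with hζ
  have hζ0 : 0 ≤ ζ := by rw [hζ]; positivity
  have h1η : 0 < 1 - η := by linarith
  have h2kf : (0 : ℝ) < 2 ^ kf := by positivity
  -- the hypotheses of (6.16) for a regular far point
  have hfam : ∀ {p : Site 4} {kp : ℕ}, IsRegularScale S c C (2 ^ kp) → p - u ∈ ann 4 (2 ^ kp) (2 * 2 ^ kp) → kf ≤ kp →
      (∀ j ∈ 𝒦, regFamily j ⊆ ann 4 (2 ^ j) (2 * 2 ^ j)) ∧ (∀ j ∈ 𝒦, (1 / 16 : ℝ) * (2 ^ j : ℝ) ^ 4 ≤ #(regFamily j)) ∧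
      (∀ j ∈ 𝒦, ∀ v ∈ regFamily j, S (p - u) ≤ (1 + 8 * C * 2 ^ j / 2 ^ kf) * S (p - u - v)) ∧
      (∀ j ∈ 𝒦, ∀ v ∈ regFamily j, ∀ q : Site 4, Site.supNorm q ≤ r → S (p - u - q) ≤ (1 + 4 * C) * S (p - u - v)) ∧
      N₄ < Site.supNorm (p - u) := by
    intro p kp hregp hp hkf
    have hpow : 2 ^ kf ≤ 2 ^ kp := Nat.pow_le_pow_right (by norm_num) hkf
    have hnorm : 2 ^ kp ≤ Site.supNorm (p - u) := (mem_ann.1 hp).1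
    have hYy : ((2 : ℝ) ^ kf) ≤ Site.supNorm (p - u) := by exact_mod_cast hpow.trans hnorm
    have hspec : ∀ j ∈ 𝒦, _ := fun j hjj =>
      regFamily_spec hS0 hC hregp hp (k := j) (r := r) ((hj j hjj).trans hpow) (hr.trans hpow) h2kf hYy
    exact ⟨fun j hjj => (hspec j hjj).1, fun j hjj => (hspec j hjj).2.1, fun j hjj => (hspec j hjj).2.2.1,
      fun j hjj => (hspec j hjj).2.2.2, by omega⟩
  obtain ⟨hsub, hcard, hdom₁, hdomθ₁, hfar₁⟩ := hfam hreg₁ hp₁ hkf₁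
  obtain ⟨-, -, hdom₂, hdomθ₂, hfar₂⟩ := hfam hreg₂ hp₂ hkf₂
  obtain ⟨-, -, hdom₁', hdomθ₁', hfar₁'⟩ := hfam hreg₁' hp₁' hkf₁'
  obtain ⟨-, -, hdom₂', hdomθ₂', hfar₂'⟩ := hfam hreg₂' hp₂' hkf₂'
  have hY : ∀ j ∈ 𝒦, (2 ^ j : ℝ) ≤ 2 ^ kf := fun j hjj => by
    have : 2 ^ j ≤ 2 ^ kf := le_trans (by omega) (hj j hjj)
    exact_mod_cast this
  have hκ : (0 : ℝ) ≤ 8 * C := by positivity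
  have hθ : (0 : ℝ) ≤ 1 + 4 * C := by positivity
  have hγ : (0 : ℝ) < 1 / 16 := by norm_num
  -- (6.16) for both pairs of far sources, and comparability on all the pairs needed
  have hA := box_mixingCore_prob_eventually' hβ hβc hCIR hIR u p₁ p₂ 𝒦 regFamily regFamily hc hC hκ hγ hη0 hη1 hsW hθ h𝒦
    hreg𝒦 hsep hY hsub hsub hcard hcard hdom₁ hdom₂ hn₀ hn₀r hrmℓ hrm h12 h23 hMR hRN hmℓ𝒦 hM𝒦 hfar₁ hfar₂ hdomθ₁ hdomθ₂
    hsW𝒦 hsW𝒦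
  have hA' := box_mixingCore_prob_eventually' hβ hβc hCIR hIR u p₁' p₂' 𝒦 regFamily regFamily hc hC hκ hγ hη0 hη1 hsW hθ h𝒦
    hreg𝒦 hsep hY hsub hsub hcard hcard hdom₁' hdom₂' hn₀ hn₀r hrmℓ hrm h12 h23 hMR hRN hmℓ𝒦 hM𝒦 hfar₁' hfar₂' hdomθ₁'
    hdomθ₂' hsW𝒦 hsW𝒦
  have hCmp := eventually_boxComparable hβ.le hη0
    ((mixPairs u p₁ 𝒦 regFamily ∪ mixPairs u p₂ 𝒦 regFamily) ∪ (mixPairs u p₁' 𝒦 regFamily ∪ mixPairs u p₂' 𝒦 regFamily))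
  filter_upwards [hA, hA', hCmp] with L hL hL' hCL
  intro hu hq₁ hq₂ hq₁' hq₂' Φ hΦ1 hΦloc
  have hK : ∀ e, 0 ≤ Kc (box 4 L) β e := fun _ => hβ.le
  -- comparabilities
  have hc₁ : BoxComparable β η L (mixPairs u p₁ 𝒦 regFamily) := hCL.mono (subset_union_left.trans subset_union_left)
  have hc₂ : BoxComparable β η L (mixPairs u p₂ 𝒦 regFamily) := hCL.mono (subset_union_right.trans subset_union_left)
  have hc₁' : BoxComparable β η L (mixPairs u p₁' 𝒦 regFamily) := hCL.mono (subset_union_left.trans subset_union_right)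
  have hc₂' : BoxComparable β η L (mixPairs u p₂' 𝒦 regFamily) := hCL.mono (subset_union_right.trans subset_union_right)
  -- notation
  set U : ↥(box 4 L) := ⟨u, hu⟩ with hU
  set T : ↥(box 4 L) → ↥(box 4 L) → ℝ := boxTwoPt (box 4 L) β with hT
  have hTle : ∀ a b : ↥(box 4 L), T a b ≤ S ((b : Site 4) - (a : Site 4)) := fun a b => boxTwoPt_le hβ.le a b
  -- the key two-point facts for a regular far point `p`
  have hkey : ∀ {p : Site 4} {kp : ℕ} (hq : p ∈ box 4 L), IsRegularScale S c C (2 ^ kp) →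
      p - u ∈ ann 4 (2 ^ kp) (2 * 2 ^ kp) → kf ≤ kp → BoxComparable β η L (mixPairs u p 𝒦 regFamily) →
      0 < T U ⟨p, hq⟩ ∧ (∀ j ∈ 𝒦, ∀ w ∈ blk U regFamily j, 0 < T U w) ∧
      (∀ j ∈ 𝒦, ∀ w ∈ blk U regFamily j,
        (1 - η) / (1 + ζ) * T U ⟨p, hq⟩ ≤ T w ⟨p, hq⟩ ∧ T w ⟨p, hq⟩ ≤ (1 + ζ) / (1 - η) * T U ⟨p, hq⟩) ∧
      (∀ j ∈ 𝒦, 0 < ∑ w ∈ blk U regFamily j, T U w * T w ⟨p, hq⟩) ∧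
      (∀ j ∈ 𝒦, 0 < ∑ w ∈ blk U regFamily j, T U w) ∧
      (∀ j ∈ 𝒦, ∀ w ∈ blk U regFamily j, 0 < T w ⟨p, hq⟩) := by
    intro p kp hq hregp hp hkf hcp
    obtain ⟨hu', hp', hIΛ, hlow, hblk⟩ := hcp.mixPairs_spec
    have hpow : 2 ^ kf ≤ 2 ^ kp := Nat.pow_le_pow_right (by norm_num) hkf
    have hnorm : 2 ^ kp ≤ Site.supNorm (p - u) := (mem_ann.1 hp).1
    have hpu0 : (0 : ℝ) < Site.supNorm (p - u) := by
      have : 0 < 2 ^ kp := pow_pos (by norm_num) kp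
      exact_mod_cast lt_of_lt_of_le this hnorm
    have hTUp : 0 < T U ⟨p, hq⟩ := lt_of_lt_of_le (mul_pos h1η (hSpos _)) hlow
    have hTUw : ∀ j ∈ 𝒦, ∀ w ∈ blk U regFamily j, 0 < T U w := fun j hjj w hw =>
      lt_of_lt_of_le (mul_pos h1η (hSpos _)) (hblk j hjj w hw).1
    have hTwp : ∀ j ∈ 𝒦, ∀ w ∈ blk U regFamily j, 0 < T w ⟨p, hq⟩ := fun j hjj w hw =>
      lt_of_lt_of_le (mul_pos h1η (hSpos _)) (hblk j hjj w hw).2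
    -- P2 at the scale of `p`
    have hshift : ∀ j ∈ 𝒦, ∀ w ∈ blk U regFamily j,
        S (p - (w : Site 4)) ≤ (1 + ζ) * S (p - u) ∧ S (p - u) ≤ (1 + ζ) * S (p - (w : Site 4)) := by
      intro j hjj w hw
      have hwI : ((w : Site 4) - u) ∈ regFamily j := by unfold blk at hw; exact (mem_filter.1 hw).2
      have hwn : Site.supNorm ((w : Site 4) - u) ≤ M₃ := (mem_ann.1 (hsub j hjj hwI)).2.trans (hM𝒦 j hjj)
      have hw2 : 2 * Site.supNorm ((w : Site 4) - u) ≤ 2 ^ kp := by omega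
      have h0 : 2 * Site.supNorm (0 : Site 4) ≤ 2 ^ kp := by rw [Site.supNorm_eq_zero_iff.2 rfl]; exact Nat.zero_le _
      have hratio : 4 * C * ((Site.supNorm ((w : Site 4) - u) : ℝ) / Site.supNorm (p - u)) ≤ ζ := by
        rw [hζ, mul_div_assoc]
        refine mul_le_mul_of_nonneg_left ?_ (by positivity)
        rw [div_le_div_iff₀ hpu0 h2kf]
        have h1 : (Site.supNorm ((w : Site 4) - u) : ℝ) ≤ M₃ := by exact_mod_cast hwn
        have h2 : ((2 : ℝ) ^ kf) ≤ Site.supNorm (p - u) := by exact_mod_cast hpow.trans hnorm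
        have hM0 : (0 : ℝ) ≤ M₃ := Nat.cast_nonneg _
        nlinarith
      constructor
      · have h := hregp.shift_le hC hS0 hp (w := (w : Site 4) - u) (w' := 0) hw2 h0
        rw [sub_zero, sub_zero, show p - u - ((w : Site 4) - u) = p - (w : Site 4) by abel] at h
        exact h.trans (mul_le_mul_of_nonneg_right (by linarith) (hS0 _))
      · have h := hregp.shift_le hC hS0 hp (w := 0) (w' := (w : Site 4) - u) h0 hw2
        rw [sub_zero, zero_sub, Site.supNorm_neg, show p - u - ((w : Site 4) - u) = p - (w : Site 4) by abel] at h
        exact h.trans (mul_le_mul_of_nonneg_right (by linarith) (hS0 _))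
    have hbounds : ∀ j ∈ 𝒦, ∀ w ∈ blk U regFamily j,
        (1 - η) / (1 + ζ) * T U ⟨p, hq⟩ ≤ T w ⟨p, hq⟩ ∧ T w ⟨p, hq⟩ ≤ (1 + ζ) / (1 - η) * T U ⟨p, hq⟩ := by
      intro j hjj w hw
      obtain ⟨hs1, hs2⟩ := hshift j hjj w hw
      have hl := (hblk j hjj w hw).2   -- (1-η) S(p-w) ≤ T w p
      have h1ζ : 0 < 1 + ζ := by linarith
      constructor
      · calc (1 - η) / (1 + ζ) * T U ⟨p, hq⟩ ≤ (1 - η) / (1 + ζ) * S (p - u) :=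
            mul_le_mul_of_nonneg_left (hTle U ⟨p, hq⟩) (by positivity)
          _ ≤ (1 - η) / (1 + ζ) * ((1 + ζ) * S (p - (w : Site 4))) := mul_le_mul_of_nonneg_left hs2 (by positivity)
          _ = (1 - η) * S (p - (w : Site 4)) := by field_simp
          _ ≤ T w ⟨p, hq⟩ := hl
      · calc T w ⟨p, hq⟩ ≤ S (p - (w : Site 4)) := hTle w ⟨p, hq⟩
          _ ≤ (1 + ζ) * S (p - u) := hs1
          _ ≤ (1 + ζ) * (T U ⟨p, hq⟩ / (1 - η)) := by
              refine mul_le_mul_of_nonneg_left ?_ h1ζ.le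
              rw [le_div_iff₀ h1η]; nlinarith
          _ = (1 + ζ) / (1 - η) * T U ⟨p, hq⟩ := by field_simp
    have hne : ∀ j ∈ 𝒦, (blk U regFamily j).Nonempty := fun j hjj => by
      rw [← Finset.card_pos]
      have h1 : (0 : ℝ) < #(regFamily j) := lt_of_lt_of_le (by positivity) (hcard j hjj)
      rw [← card_blk_eq U regFamily j (hIΛ j hjj)] at h1
      exact_mod_cast h1
    refine ⟨hTUp, hTUw, hbounds, fun j hjj => ?_, fun j hjj => ?_, hTwp⟩
    · exact Finset.sum_pos (fun w hw => mul_pos (hTUw j hjj w hw) (hTwp j hjj w hw)) (hne j hjj)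
    · exact Finset.sum_pos (fun w hw => hTUw j hjj w hw) (hne j hjj)
  obtain ⟨hT₁, hTw, hb₁, hB₁, hA0, hTw₁⟩ := hkey hq₁ hreg₁ hp₁ hkf₁ hc₁
  obtain ⟨hT₂, -, hb₂, hB₂, -, hTw₂⟩ := hkey hq₂ hreg₂ hp₂ hkf₂ hc₂
  obtain ⟨hT₁', -, hb₁', hB₁', -, hTw₁'⟩ := hkey hq₁' hreg₁' hp₁' hkf₁' hc₁'
  obtain ⟨hT₂', -, hb₂', hB₂', -, hTw₂'⟩ := hkey hq₂' hreg₂' hp₂' hkf₂' hc₂'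
  -- the reference weights and their closeness to the switch weights
  set δr : ↥(box 4 L) → ℝ := dref β U 𝒦 regFamily with hδr
  have hδr0 : ∀ v, 0 ≤ δr v := fun v => dref_nonneg U 𝒦 regFamily hβ.le v
  have hδr1 : ∑ v, δr v = 1 := sum_dref_eq_one U 𝒦 regFamily h𝒦 hA0
  have hαm : 0 < (1 - η) / (1 + ζ) := by positivity
  set μ : ℝ := ((1 + ζ) / (1 - η)) / ((1 - η) / (1 + ζ)) - 1 with hμ
  have hμ0 : 0 ≤ μ := by
    rw [hμ, sub_nonneg, le_div_iff₀ hαm, one_mul]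
    have h1 : (1 - η) / (1 + ζ) ≤ 1 := by rw [div_le_one (by linarith)]; linarith
    have h2 : 1 ≤ (1 + ζ) / (1 - η) := by rw [le_div_iff₀ h1η]; linarith
    linarith
  have hμ' : (1 + μ) ^ 2 - 1 = (1 + ζ) ^ 4 / (1 - η) ^ 4 - 1 := by
    rw [hμ]; field_simp; ring
  have hclose : ∀ {p : Site 4} (hq : p ∈ box 4 L), 0 < T U ⟨p, hq⟩ →
      (∀ j ∈ 𝒦, ∀ w ∈ blk U regFamily j,
        (1 - η) / (1 + ζ) * T U ⟨p, hq⟩ ≤ T w ⟨p, hq⟩ ∧ T w ⟨p, hq⟩ ≤ (1 + ζ) / (1 - η) * T U ⟨p, hq⟩) →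
      ∀ v, |dcoef β U ⟨p, hq⟩ 𝒦 regFamily v - δr v| ≤ μ * δr v := by
    intro p hq hTp hb v
    exact abs_dcoef_sub_dref_le U 𝒦 regFamily ⟨p, hq⟩ hαm hTp hTw (fun j hjj w hw => (hb j hjj w hw).1)
      (fun j hjj w hw => (hb j hjj w hw).2) v
  -- the functional of the inner sources
  set f : ↥(box 4 L) → ↥(box 4 L) → ℝ := fun v₁ v₂ => srcProb (Kc (box 4 L) β) ({U} ∆ {v₁}) ({U} ∆ {v₂}) Φ with hf
  have hf0 : ∀ v₁ v₂, 0 ≤ f v₁ v₂ := fun v₁ v₂ => srcProb_nonneg _ _ _ _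
  have hf1 : ∀ v₁ v₂, f v₁ v₂ ≤ 1 := fun v₁ v₂ => srcProb_le_one hK _ _ hΦ1
  have hΦmul : Φ * (fun _ => (1 : ℝ≥0∞)) = Φ := by funext x; simp
  -- one far pair: `|P - ∑ δr δr f| ≤ concErr + splitErr + ((1+μ)²-1)`
  have hone : ∀ {q₁ q₂ : Site 4} (hw₁ : q₁ ∈ box 4 L) (hw₂ : q₂ ∈ box 4 L),
      (∀ Φ Ψ : FourCfg (boxGraph (box 4 L)) → ℝ≥0∞, (∀ pq, Φ pq ≤ 1) → (∀ pq, Ψ pq ≤ 1) →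
        FourLocal (edgesWithin (G := boxGraph (box 4 L)) ⟨u, hu⟩ n₀) Φ →
        FourLocal (edgesBeyond (G := boxGraph (box 4 L)) ⟨u, hu⟩ (N₄ + 1)) Ψ →
        |srcProb (Kc (box 4 L) β) ({⟨u, hu⟩} ∆ {⟨q₁, hw₁⟩}) ({⟨u, hu⟩} ∆ {⟨q₂, hw₂⟩}) (Φ * Ψ) -
          ∑ v₁, ∑ v₂, switchWeight (Kc (box 4 L) β) ⟨u, hu⟩ ⟨u, hu⟩ ⟨q₁, hw₁⟩ ⟨q₂, hw₂⟩
              (mixCoeff β ⟨u, hu⟩ ⟨q₁, hw₁⟩ 𝒦 regFamily) (mixCoeff β ⟨u, hu⟩ ⟨q₂, hw₂⟩ 𝒦 regFamily) v₁ v₂ *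
            (srcProb (Kc (box 4 L) β) ({⟨u, hu⟩} ∆ {v₁}) ({⟨u, hu⟩} ∆ {v₂}) Φ *
              srcProb (Kc (box 4 L) β) ({v₁} ∆ {⟨q₁, hw₁⟩}) ({v₂} ∆ {⟨q₂, hw₂⟩}) Ψ)| ≤
        concErr c C (8 * C) (1 / 16) η #𝒦 + splitErr CIR η sW (1 + 4 * C) n₀ r mℓ m₀ M₃ R N₄) →
      0 < T U ⟨q₁, hw₁⟩ → 0 < T U ⟨q₂, hw₂⟩ →
      (∀ j ∈ 𝒦, ∀ w ∈ blk U regFamily j,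
        (1 - η) / (1 + ζ) * T U ⟨q₁, hw₁⟩ ≤ T w ⟨q₁, hw₁⟩ ∧ T w ⟨q₁, hw₁⟩ ≤ (1 + ζ) / (1 - η) * T U ⟨q₁, hw₁⟩) →
      (∀ j ∈ 𝒦, ∀ w ∈ blk U regFamily j,
        (1 - η) / (1 + ζ) * T U ⟨q₂, hw₂⟩ ≤ T w ⟨q₂, hw₂⟩ ∧ T w ⟨q₂, hw₂⟩ ≤ (1 + ζ) / (1 - η) * T U ⟨q₂, hw₂⟩) →
      (∀ j ∈ 𝒦, 0 < ∑ w ∈ blk U regFamily j, T U w * T w ⟨q₁, hw₁⟩) →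
      (∀ j ∈ 𝒦, 0 < ∑ w ∈ blk U regFamily j, T U w * T w ⟨q₂, hw₂⟩) →
      (∀ j ∈ 𝒦, ∀ w ∈ blk U regFamily j, 0 < T w ⟨q₁, hw₁⟩) →
      (∀ j ∈ 𝒦, ∀ w ∈ blk U regFamily j, 0 < T w ⟨q₂, hw₂⟩) →
      |srcProb (Kc (box 4 L) β) ({U} ∆ {⟨q₁, hw₁⟩}) ({U} ∆ {⟨q₂, hw₂⟩}) Φ - ∑ x : ↥(box 4 L) × ↥(box 4 L), δr x.1 * δr x.2 * f x.1 x.2| ≤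
        concErr c C (8 * C) (1 / 16) η #𝒦 + splitErr CIR η sW (1 + 4 * C) n₀ r mℓ m₀ M₃ R N₄ + ((1 + μ) ^ 2 - 1) := by
    intro q₁ q₂ hw₁ hw₂ hAq hTq₁ hTq₂ hbq₁ hbq₂ hBq₁ hBq₂ hTwq₁ hTwq₂
    set Q₁ : ↥(box 4 L) := ⟨q₁, hw₁⟩ with hQ₁
    set Q₂ : ↥(box 4 L) := ⟨q₂, hw₂⟩ with hQ₂
    set sw : ↥(box 4 L) → ↥(box 4 L) → ℝ := fun v₁ v₂ => switchWeight (Kc (box 4 L) β) U U Q₁ Q₂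
      (mixCoeff β U Q₁ 𝒦 regFamily) (mixCoeff β U Q₂ 𝒦 regFamily) v₁ v₂ with hsw
    -- (6.16) with the full outside event
    have h := hAq Φ (fun _ => 1) hΦ1 (fun _ => le_rfl) hΦloc (fourLocal_const _ 1)
    rw [hΦmul] at h
    -- `P^{v q}[1] = 1` on the support of the switch weights
    have hsum : ∑ v₁, ∑ v₂, sw v₁ v₂ * (f v₁ v₂ * srcProb (Kc (box 4 L) β) ({v₁} ∆ {Q₁}) ({v₂} ∆ {Q₂}) (fun _ => 1)) =
        ∑ v₁, ∑ v₂, sw v₁ v₂ * f v₁ v₂ := by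
      refine Finset.sum_congr rfl fun v₁ _ => Finset.sum_congr rfl fun v₂ _ => ?_
      by_cases h0 : sw v₁ v₂ = 0
      · rw [h0, zero_mul, zero_mul]
      · obtain ⟨⟨j₁, hj₁, hv₁⟩, ⟨j₂, hj₂, hv₂⟩⟩ := switchWeight_ne_zero_imp U Q₁ Q₂ 𝒦 regFamily regFamily h0
        have hv₁b : v₁ ∈ blk U regFamily j₁ := by unfold blk; simpa using hv₁
        have hv₂b : v₂ ∈ blk U regFamily j₂ := by unfold blk; simpa using hv₂
        have hZ : ∀ {a b : ↥(box 4 L)}, 0 < T a b → ecurrentSum (Kc (box 4 L) β) ({a} ∆ {b}) ≠ 0 := by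
          intro a b hab h0'
          rw [hT, boxTwoPt_eq_div hβ.le, h0', ENNReal.toReal_zero, zero_div] at hab
          exact lt_irrefl _ hab
        have hN : srcNrm (Kc (box 4 L) β) ({v₁} ∆ {Q₁}) ({v₂} ∆ {Q₂}) ≠ 0 := by
          unfold srcNrm
          exact mul_ne_zero (mul_ne_zero (ecurrentSum_empty_ne_zero _) (hZ (hTwq₁ j₁ hj₁ v₁ hv₁b)))
            (mul_ne_zero (ecurrentSum_empty_ne_zero _) (hZ (hTwq₂ j₂ hj₂ v₂ hv₂b)))
        rw [srcProb_one hK hN, mul_one]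
    rw [hsum] at h
    -- factorisation and closeness of the switch weights
    have hswprod : ∀ v₁ v₂, sw v₁ v₂ = dcoef β U Q₁ 𝒦 regFamily v₁ * dcoef β U Q₂ 𝒦 regFamily v₂ := fun v₁ v₂ =>
      switchWeight_mixCoeff U 𝒦 hβ.le Q₁ Q₂ regFamily regFamily hBq₁ hBq₂ hTq₁ hTq₂ v₁ v₂
    have hcomp : ∀ x ∈ (univ : Finset (↥(box 4 L) × ↥(box 4 L))), |δr x.1 * δr x.2 - sw x.1 x.2| ≤ ((1 + μ) ^ 2 - 1) * (δr x.1 * δr x.2) := by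
      intro x _
      rw [hswprod, abs_sub_comm]
      exact abs_mul_sub_mul_le_of_rel hμ0 (hδr0 _) (hδr0 _) (dcoef_nonneg U 𝒦 regFamily hβ.le Q₁ _)
        (dcoef_nonneg U 𝒦 regFamily hβ.le Q₂ _) (hclose hw₁ hTq₁ hbq₁ x.1) (hclose hw₂ hTq₂ hbq₂ x.2)
    have hδ1 : ∑ x : ↥(box 4 L) × ↥(box 4 L), δr x.1 * δr x.2 = 1 := by
      rw [Fintype.sum_prod_type, ← Finset.sum_mul_sum, hδr1, mul_one]
    have hwt := abs_weighted_sub_weighted_le (univ : Finset (↥(box 4 L) × ↥(box 4 L))) (δ := fun x => δr x.1 * δr x.2)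
      (δ' := fun x => sw x.1 x.2) (f := fun x => f x.1 x.2) hδ1 hcomp (fun x _ => hf0 _ _) (fun x _ => hf1 _ _)
    have hnest : ∑ x : ↥(box 4 L) × ↥(box 4 L), sw x.1 x.2 * f x.1 x.2 = ∑ v₁, ∑ v₂, sw v₁ v₂ * f v₁ v₂ := Fintype.sum_prod_type _
    rw [hnest] at hwt
    calc |srcProb (Kc (box 4 L) β) ({U} ∆ {Q₁}) ({U} ∆ {Q₂}) Φ - ∑ x : ↥(box 4 L) × ↥(box 4 L), δr x.1 * δr x.2 * f x.1 x.2|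
        = |(srcProb (Kc (box 4 L) β) ({U} ∆ {Q₁}) ({U} ∆ {Q₂}) Φ - ∑ v₁, ∑ v₂, sw v₁ v₂ * f v₁ v₂) -
            (∑ x : ↥(box 4 L) × ↥(box 4 L), δr x.1 * δr x.2 * f x.1 x.2 - ∑ v₁, ∑ v₂, sw v₁ v₂ * f v₁ v₂)| := by ring_nf
      _ ≤ |srcProb (Kc (box 4 L) β) ({U} ∆ {Q₁}) ({U} ∆ {Q₂}) Φ - ∑ v₁, ∑ v₂, sw v₁ v₂ * f v₁ v₂| +
            |∑ x : ↥(box 4 L) × ↥(box 4 L), δr x.1 * δr x.2 * f x.1 x.2 - ∑ v₁, ∑ v₂, sw v₁ v₂ * f v₁ v₂| := abs_sub _ _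
      _ ≤ _ := add_le_add h hwt
  have h1 := hone hq₁ hq₂ (hL hu hq₁ hq₂) hT₁ hT₂ hb₁ hb₂ hB₁ hB₂ hTw₁ hTw₂
  have h2 := hone hq₁' hq₂' (hL' hu hq₁' hq₂') hT₁' hT₂' hb₁' hb₂' hB₁' hB₂' hTw₁' hTw₂'
  rw [hμ'] at h1 h2
  unfold odErr
  calc |srcProb (Kc (box 4 L) β) ({U} ∆ {⟨p₁, hq₁⟩}) ({U} ∆ {⟨p₂, hq₂⟩}) Φ - srcProb (Kc (box 4 L) β) ({U} ∆ {⟨p₁', hq₁'⟩}) ({U} ∆ {⟨p₂', hq₂'⟩}) Φ|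
      = |(srcProb (Kc (box 4 L) β) ({U} ∆ {⟨p₁, hq₁⟩}) ({U} ∆ {⟨p₂, hq₂⟩}) Φ - ∑ x : ↥(box 4 L) × ↥(box 4 L), δr x.1 * δr x.2 * f x.1 x.2) -
          (srcProb (Kc (box 4 L) β) ({U} ∆ {⟨p₁', hq₁'⟩}) ({U} ∆ {⟨p₂', hq₂'⟩}) Φ - ∑ x : ↥(box 4 L) × ↥(box 4 L), δr x.1 * δr x.2 * f x.1 x.2)| := by
        ring_nf
    _ ≤ |srcProb (Kc (box 4 L) β) ({U} ∆ {⟨p₁, hq₁⟩}) ({U} ∆ {⟨p₂, hq₂⟩}) Φ - ∑ x : ↥(box 4 L) × ↥(box 4 L), δr x.1 * δr x.2 * f x.1 x.2| +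
        |srcProb (Kc (box 4 L) β) ({U} ∆ {⟨p₁', hq₁'⟩}) ({U} ∆ {⟨p₂', hq₂'⟩}) Φ - ∑ x : ↥(box 4 L) × ↥(box 4 L), δr x.1 * δr x.2 * f x.1 x.2| :=
        abs_sub _ _
    _ ≤ _ := by linarith

end Current

end Literature.Probability.LatticeModels

/-!
# The random currents' mixing property on `ℤ⁴` (Aizenman–Duminil-Copin 2021, Theorem 6.4, (6.8) and (6.9), `t = 2`, `s = 4`)

Topic `Literature/Probability/LatticeModels`. Theorems only; **no named fact is introduced** (D-0026).

M. Aizenman, H. Duminil-Copin, Ann. of Math. **194** (2021) = arXiv:1912.07973, **Theorem 6.4** (random currents'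
mixing property, p. 21–22): "For `d ≥ 4`, there exist `α, c > 0` such that for every `t ≤ s`, every `β ≤ β_c`,
every `n^α ≤ N ≤ ξ(β)`, every `x_i ∈ Λ_n` and `y_i ∉ Λ_N` (`i ≤ t`), and every events `E` and `F` depending on the
restriction of `(n₁,…,n_s)` to edges within `Λ_n` and outside of `Λ_N` respectively,
(6.8) `|P^{x₁y₁,…,x_ty_t,∅,…,∅}_β[E ∩ F] - P[E]P[F]| ≤ s(log N/n)^{-c}`. Furthermore, for every `x'_i ∈ Λ_n` and
`y'_i ∉ Λ_N`, (6.9) `|P^{x₁y₁,…}[E] - P^{x₁y'₁,…}[E]| ≤ s(log N/n)^{-c}` …".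

This file proves the two instances used in §6.1 (proof of Proposition 6.1), in the finite-volume, one-sided,
`[0,1]`-functional form in which `IntersectionClusteringBound.improvedTreeDiagramBound_of_intersection_and_mixing`
consumes them (its hypotheses `Hmix`, `Hrel`): `t = 2`, `s = 4`, both inner sources at the centre `u`, far
sources `(y,y)` resp. `(x,z)` versus `(y,y)`, along the boxes `Λ_L ↑ ℤ⁴`:

* `Current.mixing_Hmix` — **(6.8)**: `E^{uy,uy}_Λ[ΦΨ]·N ≤ E[Φ]E[Ψ] + C(log N/n)^{-1/2} N²` eventually in `L`;
* `Current.mixing_Hrel` — **(6.9)**: `E^{ux,uz}_Λ[Φ]·N_{yy} ≤ E^{uy,uy}_Λ[Φ]·N_{xz} + C(log N/n)^{-1/2} N_{xz}N_{yy}`.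

Proof (§6.2, pp. 23–26, with the scales of `MixingBoxGrid`): (6.16) on `Λ_L` (`MixingBoxRelocation.box_mixingCore_prob_eventually'`,
index sets `arbFamily` for the arbitrary far sources — the sets `𝔸_y` of Remark 6.5), the regular-case relocation
(6.9) between switch points (`box_relocation_regular`, "(eq:od)"), the pivot step (6.20) and the final algebra
("applying (6.16) for `E, F, N, n`, the previous inequality for `E, m, n`, and then again (6.16) for `F`"), the set `𝒦`
of separated regular scales (`MixingScales`), and the smallness of all the error terms on the dyadic grid
(`MixingBoxGrid`: `≤ C/√log(N/n)` with `α = 20000`, `c = 1/2`).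

## References

* M. Aizenman, H. Duminil-Copin, Ann. of Math. 194 (2021), arXiv:1912.07973, Theorem 6.4 (pp. 21–22) and §6.2
  (pp. 23–26) [AizenmanDuminilCopinAnnals2021].
* R. Panis, arXiv:2309.05797, §6.4 [Panis2023Triviality].
-/

noncomputable section

open Finset Filter
open scoped symmDiff ENNReal

namespace Literature.Probability.LatticeModels

/-! ### Real-variable endgame -/

/-- **(6.8) from (6.16), the pointwise relocation of the inside functional and the averaged relocation of the
outside functional**: if `|P - ∑δ fg| ≤ e₁`, `|f - P_E| ≤ e₂` on the support of `δ`, `|P_F - ∑ δ g| ≤ e₃`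
(`δ ≥ 0`, `∑δ = 1`, `g ∈ [0,1]`, `P_E ∈ [0,1]`), then `|P - P_E P_F| ≤ e₁ + e₂ + e₃`.
[cite: AizenmanDuminilCopinAnnals2021, arXiv:1912.07973 §6.2, proof of Thm 6.4, last paragraph (p. 26)] -/
theorem abs_sub_mul_le_of_switch' {ι : Type*} (s : Finset ι) {δ f g : ι → ℝ} {P PE PF e₁ e₂ e₃ : ℝ}
    (hδ0 : ∀ i ∈ s, 0 ≤ δ i) (hδ1 : ∑ i ∈ s, δ i = 1)
    (hP : |P - ∑ i ∈ s, δ i * (f i * g i)| ≤ e₁) (hf : ∀ i ∈ s, δ i ≠ 0 → |f i - PE| ≤ e₂)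
    (hg : |PF - ∑ i ∈ s, δ i * g i| ≤ e₃) (hg0 : ∀ i ∈ s, 0 ≤ g i) (hg1 : ∀ i ∈ s, g i ≤ 1)
    (hPE0 : 0 ≤ PE) (hPE1 : PE ≤ 1) :
    |P - PE * PF| ≤ e₁ + e₂ + e₃ := by
  -- the middle term
  have hmid : |∑ i ∈ s, δ i * (f i * g i) - PE * ∑ i ∈ s, δ i * g i| ≤ e₂ := by
    have he₂ : 0 ≤ e₂ ∨ ∀ i ∈ s, δ i = 0 := by
      by_cases h : ∃ i ∈ s, δ i ≠ 0
      · obtain ⟨i, hi, hne⟩ := h; exact Or.inl ((abs_nonneg _).trans (hf i hi hne))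
      · push Not at h; exact Or.inr h
    rcases he₂ with he₂ | hzero
    · calc |∑ i ∈ s, δ i * (f i * g i) - PE * ∑ i ∈ s, δ i * g i| = |∑ i ∈ s, δ i * ((f i - PE) * g i)| := by
            rw [Finset.mul_sum, ← Finset.sum_sub_distrib]
            congr 1
            exact Finset.sum_congr rfl fun i _ => by ring
        _ ≤ ∑ i ∈ s, |δ i * ((f i - PE) * g i)| := Finset.abs_sum_le_sum_abs _ _
        _ ≤ ∑ i ∈ s, δ i * e₂ := by
            refine Finset.sum_le_sum fun i hi => ?_
            rw [abs_mul, abs_of_nonneg (hδ0 i hi), abs_mul, abs_of_nonneg (hg0 i hi)]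
            by_cases hne : δ i = 0
            · rw [hne]; simp
            · refine mul_le_mul_of_nonneg_left ?_ (hδ0 i hi)
              calc |f i - PE| * g i ≤ e₂ * 1 := mul_le_mul (hf i hi hne) (hg1 i hi) (hg0 i hi) he₂
                _ = e₂ := mul_one _
        _ = e₂ := by rw [← Finset.sum_mul, hδ1, one_mul]
    · exfalso
      have : ∑ i ∈ s, δ i = 0 := Finset.sum_eq_zero hzero
      rw [hδ1] at this; exact one_ne_zero this
  have hlast : |PE * ∑ i ∈ s, δ i * g i - PE * PF| ≤ e₃ := by
    rw [← mul_sub, abs_mul, abs_of_nonneg hPE0, abs_sub_comm]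
    calc PE * |PF - ∑ i ∈ s, δ i * g i| ≤ 1 * e₃ := mul_le_mul hPE1 hg (abs_nonneg _) zero_le_one
      _ = e₃ := one_mul _
  calc |P - PE * PF| = |(P - ∑ i ∈ s, δ i * (f i * g i)) + (∑ i ∈ s, δ i * (f i * g i) - PE * ∑ i ∈ s, δ i * g i) +
        (PE * ∑ i ∈ s, δ i * g i - PE * PF)| := by ring_nf
    _ ≤ |P - ∑ i ∈ s, δ i * (f i * g i)| + |∑ i ∈ s, δ i * (f i * g i) - PE * ∑ i ∈ s, δ i * g i| +
        |PE * ∑ i ∈ s, δ i * g i - PE * PF| := abs_add_three _ _ _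
    _ ≤ e₁ + e₂ + e₃ := add_le_add (add_le_add hP hmid) hlast

namespace Current

variable {V : Type*} [Fintype V] [DecidableEq V] {G : SimpleGraph V} [DecidableRel G.Adj] {K : G.edgeFinset → ℝ}

/-- From the normalised (6.8) to the cross-multiplied form: `P[ΦΨ] ≤ P[Φ]P[Ψ] + E` gives
`M[ΦΨ]·N ≤ M[Φ]M[Ψ] + E·N²` (`N` the non-vanishing normalisation). [folklore] -/
theorem srcMass_mul_le_of_srcProb_le (hK : ∀ e, 0 ≤ K e) {A₁ A₂ : Finset V} (hN : srcNrm K A₁ A₂ ≠ 0)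
    {Φ Ψ : FourCfg G → ℝ≥0∞} (hΦ1 : ∀ pq, Φ pq ≤ 1) (hΨ1 : ∀ pq, Ψ pq ≤ 1) {E : ℝ} (hE : 0 ≤ E)
    (h : srcProb K A₁ A₂ (Φ * Ψ) ≤ srcProb K A₁ A₂ Φ * srcProb K A₁ A₂ Ψ + E) :
    srcMass K A₁ A₂ (Φ * Ψ) * srcNrm K A₁ A₂ ≤
      srcMass K A₁ A₂ Φ * srcMass K A₁ A₂ Ψ + ENNReal.ofReal E * srcNrm K A₁ A₂ ^ 2 := by
  have hNtop : srcNrm K A₁ A₂ ≠ ∞ := by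
    unfold srcNrm
    exact ENNReal.mul_ne_top (ENNReal.mul_ne_top (ecurrentSum_ne_top hK _) (ecurrentSum_ne_top hK _))
      (ENNReal.mul_ne_top (ecurrentSum_ne_top hK _) (ecurrentSum_ne_top hK _))
  have hΦΨ1 : ∀ pq, (Φ * Ψ) pq ≤ 1 := fun pq => by
    rw [Pi.mul_apply]; exact (mul_le_mul' (hΦ1 pq) (hΨ1 pq)).trans (le_of_eq (one_mul 1))
  have hMtop : ∀ {Θ : FourCfg G → ℝ≥0∞}, (∀ pq, Θ pq ≤ 1) → srcMass K A₁ A₂ Θ ≠ ∞ := fun hΘ =>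
    ne_top_of_le_ne_top hNtop (srcMass_le_srcNrm K A₁ A₂ hΘ)
  set n : ℝ := (srcNrm K A₁ A₂).toReal with hn
  have hnpos : 0 < n := ENNReal.toReal_pos hN hNtop
  have hP : ∀ {Θ : FourCfg G → ℝ≥0∞}, (∀ pq, Θ pq ≤ 1) → (srcMass K A₁ A₂ Θ).toReal = srcProb K A₁ A₂ Θ * n := by
    intro Θ hΘ; unfold srcProb; rw [div_mul_cancel₀ _ hnpos.ne']
  rw [← ENNReal.toReal_le_toReal (ENNReal.mul_ne_top (hMtop hΦΨ1) hNtop)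
    (ENNReal.add_ne_top.2 ⟨ENNReal.mul_ne_top (hMtop hΦ1) (hMtop hΨ1), ENNReal.mul_ne_top ENNReal.ofReal_ne_top
      (ENNReal.pow_ne_top hNtop)⟩), ENNReal.toReal_mul, ENNReal.toReal_add (ENNReal.mul_ne_top (hMtop hΦ1) (hMtop hΨ1))
      (ENNReal.mul_ne_top ENNReal.ofReal_ne_top (ENNReal.pow_ne_top hNtop)), ENNReal.toReal_mul, ENNReal.toReal_mul,
    ENNReal.toReal_pow, ENNReal.toReal_ofReal hE, hP hΦΨ1, hP hΦ1, hP hΨ1, ← hn]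
  have h0 : 0 ≤ srcProb K A₁ A₂ (Φ * Ψ) := srcProb_nonneg K A₁ A₂ _
  nlinarith [mul_le_mul_of_nonneg_right h (mul_nonneg hnpos.le hnpos.le)]

/-- From the normalised (6.9) to the cross-multiplied form: `P_A[Φ] ≤ P_B[Φ] + E` gives
`M_A[Φ]·N_B ≤ M_B[Φ]·N_A + E·N_A N_B`. [folklore] -/
theorem srcMass_mul_le_of_srcProb_le' (hK : ∀ e, 0 ≤ K e) {A₁ A₂ B₁ B₂ : Finset V} (hNA : srcNrm K A₁ A₂ ≠ 0)
    (hNB : srcNrm K B₁ B₂ ≠ 0) {Φ : FourCfg G → ℝ≥0∞} (hΦ1 : ∀ pq, Φ pq ≤ 1) {E : ℝ} (hE : 0 ≤ E)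
    (h : srcProb K A₁ A₂ Φ ≤ srcProb K B₁ B₂ Φ + E) :
    srcMass K A₁ A₂ Φ * srcNrm K B₁ B₂ ≤
      srcMass K B₁ B₂ Φ * srcNrm K A₁ A₂ + ENNReal.ofReal E * (srcNrm K A₁ A₂ * srcNrm K B₁ B₂) := by
  have hNtop : ∀ C₁ C₂ : Finset V, srcNrm K C₁ C₂ ≠ ∞ := fun C₁ C₂ => by
    unfold srcNrm
    exact ENNReal.mul_ne_top (ENNReal.mul_ne_top (ecurrentSum_ne_top hK _) (ecurrentSum_ne_top hK _))
      (ENNReal.mul_ne_top (ecurrentSum_ne_top hK _) (ecurrentSum_ne_top hK _))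
  have hMtop : ∀ C₁ C₂ : Finset V, srcMass K C₁ C₂ Φ ≠ ∞ := fun C₁ C₂ =>
    ne_top_of_le_ne_top (hNtop C₁ C₂) (srcMass_le_srcNrm K C₁ C₂ hΦ1)
  set a : ℝ := (srcNrm K A₁ A₂).toReal with ha
  set b : ℝ := (srcNrm K B₁ B₂).toReal with hb
  have hapos : 0 < a := ENNReal.toReal_pos hNA (hNtop _ _)
  have hbpos : 0 < b := ENNReal.toReal_pos hNB (hNtop _ _)
  have hPA : (srcMass K A₁ A₂ Φ).toReal = srcProb K A₁ A₂ Φ * a := by unfold srcProb; rw [div_mul_cancel₀ _ hapos.ne']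
  have hPB : (srcMass K B₁ B₂ Φ).toReal = srcProb K B₁ B₂ Φ * b := by unfold srcProb; rw [div_mul_cancel₀ _ hbpos.ne']
  rw [← ENNReal.toReal_le_toReal (ENNReal.mul_ne_top (hMtop _ _) (hNtop _ _))
    (ENNReal.add_ne_top.2 ⟨ENNReal.mul_ne_top (hMtop _ _) (hNtop _ _), ENNReal.mul_ne_top ENNReal.ofReal_ne_top
      (ENNReal.mul_ne_top (hNtop _ _) (hNtop _ _))⟩), ENNReal.toReal_mul, ENNReal.toReal_add
      (ENNReal.mul_ne_top (hMtop _ _) (hNtop _ _)) (ENNReal.mul_ne_top ENNReal.ofReal_ne_top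
      (ENNReal.mul_ne_top (hNtop _ _) (hNtop _ _))), ENNReal.toReal_mul, ENNReal.toReal_mul, ENNReal.toReal_mul,
    ENNReal.toReal_ofReal hE, hPA, hPB, ← ha, ← hb]
  have h0 : 0 ≤ srcProb K B₁ B₂ Φ := srcProb_nonneg K B₁ B₂ _
  nlinarith [mul_le_mul_of_nonneg_right h (mul_nonneg hapos.le hbpos.le)]

end Current

/-! ### Dictionary with the finite-volume quantities of `IntersectionClusteringBound` -/

/-- `finVolFourMass Λ β u a b Θ = srcMass (Kc Λ β) ({u}Δ{a}) ({u}Δ{b}) Θ` for points of `Λ`. [folklore] -/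
theorem finVolFourMass_eq_srcMass {Λ : Finset (Site 4)} (β : ℝ) {u a b : Site 4} (hu : u ∈ Λ) (ha : a ∈ Λ) (hb : b ∈ Λ)
    (Θ : Current.FourCfg (boxGraph Λ) → ℝ≥0∞) :
    finVolFourMass Λ β u a b Θ = Current.srcMass (Kc Λ β) ({⟨u, hu⟩} ∆ {⟨a, ha⟩}) ({⟨u, hu⟩} ∆ {⟨b, hb⟩}) Θ := by
  rw [finVolFourMass_eq β hu ha hb, Current.fourMass_eq_srcMass, symmDiff_comm, symmDiff_comm ({⟨b, hb⟩} : Finset ↥Λ)]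

/-- `finVolFourNrm Λ β u a b = srcNrm (Kc Λ β) ({u}Δ{a}) ({u}Δ{b})` for points of `Λ`. [folklore] -/
theorem finVolFourNrm_eq_srcNrm {Λ : Finset (Site 4)} (β : ℝ) {u a b : Site 4} (hu : u ∈ Λ) (ha : a ∈ Λ) (hb : b ∈ Λ) :
    finVolFourNrm Λ β u a b = Current.srcNrm (Kc Λ β) ({⟨u, hu⟩} ∆ {⟨a, ha⟩}) ({⟨u, hu⟩} ∆ {⟨b, hb⟩}) := by
  rw [finVolFourNrm_eq β hu ha hb, Current.fourNrm_eq_srcNrm, symmDiff_comm, symmDiff_comm ({⟨b, hb⟩} : Finset ↥Λ)]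

/-! ### (6.8) at a fixed grid parameter -/

namespace Current

/-- Elementary order facts between the dyadic scales of the grid (`1 ≤ Q`). [folklore] -/
theorem pow_grid_le {a b Q : ℕ} (h : a ≤ b) : 2 ^ (a * Q) ≤ 2 ^ (b * Q) :=
  Nat.pow_le_pow_right (by norm_num) (Nat.mul_le_mul_right Q h)

/-- Strict version. [folklore] -/
theorem pow_grid_lt {a b Q : ℕ} (hQ : 1 ≤ Q) (h : a < b) : 2 ^ (a * Q) < 2 ^ (b * Q) :=
  Nat.pow_lt_pow_right (by norm_num) (by nlinarith)

set_option maxHeartbeats 2000000 in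
open Classical in
/-- **(6.8) on `Λ_L`, `t = 2`, `s = 4`, centre sources, far sources `(y,y)`, at a fixed grid parameter `Q`**, with
the sets of separated regular scales `𝒦 ⊆ [200Q, 999Q]` (top) and `𝒦' ⊆ [7Q, 19Q]` (for the relocation (6.9)) given:
for all large `L`, `|P^{uy,uy}_{Λ_L}[ΦΨ] - P[Φ]P[Ψ]| ≤ 3ε₁ + ε₂`, `ε₁` the (6.16) error at the top level (far source
arbitrary: index sets `arbFamily`), `ε₂ = odErr` at the lower level. [cite: AizenmanDuminilCopinAnnals2021, arXiv:1912.07973 §6.2, proof of Thm 6.4: (6.16), (6.20) and "applying (6.16) for E, F, N and n, the previous inequality for E, m and n, and then again (6.16) for F" (pp. 25–26)] -/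
theorem mixing_at_scale {β : ℝ} (hβ : 0 < β) (hβc : β ≤ criticalBeta 4) {CIR : ℝ} (hCIR : 0 ≤ CIR)
    (hIR : ∀ x : Site 4, x ≠ 0 → twoPointFree 4 β x ≤ CIR / (Site.supNorm x : ℝ) ^ 2)
    (u y : Site 4) {c₀ C₀ : ℝ} (hc₀ : 0 < c₀) (hC₀ : 0 < C₀) (𝒦 𝒦' : Finset ℕ) {Q n N : ℕ}
    (hQ : 1 ≤ Q) (hn : 1 ≤ n) (hnQ : n < 2 ^ Q) (hN : 2 ^ (10000 * Q) ≤ N)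
    (hwin : β = criticalBeta 4 ∨ (0 < β ∧ (N : ℝ) * invCorrLength (twoPointPlus 4 β) ≤ 1))
    (hyN : N ≤ Site.supNorm (y - u))
    (h𝒦 : ∀ k ∈ 𝒦, 200 * Q ≤ k ∧ k ≤ 999 * Q) (hreg : ∀ k ∈ 𝒦, IsRegularScale (twoPointFree 4 β) c₀ C₀ (2 ^ k))
    (hsep : ∀ k ∈ 𝒦, ∀ k' ∈ 𝒦, k < k' → (C₀ + 2) * 2 ^ k < (2 ^ k' : ℝ)) (hcard : 10 ≤ #𝒦)
    (h𝒦' : ∀ j ∈ 𝒦', 7 * Q ≤ j ∧ j ≤ 19 * Q) (hreg' : ∀ j ∈ 𝒦', IsRegularScale (twoPointFree 4 β) c₀ C₀ (2 ^ j))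
    (hsep' : ∀ j ∈ 𝒦', ∀ j' ∈ 𝒦', j < j' → (C₀ + 2) * 2 ^ j < (2 ^ j' : ℝ)) (hcard' : 10 ≤ #𝒦') :
    ∀ᶠ L : ℕ in atTop, ∀ (hu : u ∈ box 4 L) (hy : y ∈ box 4 L),
      ∀ Φ Ψ : FourCfg (boxGraph (box 4 L)) → ℝ≥0∞, (∀ pq, Φ pq ≤ 1) → (∀ pq, Ψ pq ≤ 1) →
        FourLocal (edgesWithin (G := boxGraph (box 4 L)) ⟨u, hu⟩ n) Φ →
        FourLocal (edgesBeyond (G := boxGraph (box 4 L)) ⟨u, hu⟩ N) Ψ →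
        |srcProb (Kc (box 4 L) β) ({⟨u, hu⟩} ∆ {⟨y, hy⟩}) ({⟨u, hu⟩} ∆ {⟨y, hy⟩}) (Φ * Ψ) -
          srcProb (Kc (box 4 L) β) ({⟨u, hu⟩} ∆ {⟨y, hy⟩}) ({⟨u, hu⟩} ∆ {⟨y, hy⟩}) Φ *
            srcProb (Kc (box 4 L) β) ({⟨u, hu⟩} ∆ {⟨y, hy⟩}) ({⟨u, hu⟩} ∆ {⟨y, hy⟩}) Ψ| ≤
        3 * (concErr c₀ C₀ 0 (1 / 4096) (1 / #𝒦) #𝒦 +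
              splitErr CIR (1 / #𝒦) (Real.exp (-2) / (32 * criticalBeta 4) / (216 * (16 * ((2 ^ (1000 * Q) : ℕ) : ℝ)) ^ 3)) 1 n
                (2 ^ (100 * Q)) (2 ^ (200 * Q)) (2 ^ (200 * Q) - 1) (2 ^ (1000 * Q)) (2 ^ (3100 * Q)) (N - 1)) +
          odErr c₀ C₀ CIR (1 / #𝒦') (Real.exp (-2) / (32 * criticalBeta 4) / (216 * (16 * ((2 ^ (20 * Q) : ℕ) : ℝ)) ^ 3))
            (4 * C₀ * (2 ^ (20 * Q) : ℕ) / 2 ^ (200 * Q)) #𝒦' n (2 ^ (4 * Q)) (2 ^ (7 * Q)) (2 ^ (7 * Q) - 1)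
            (2 ^ (20 * Q)) (2 ^ (64 * Q)) (2 ^ (196 * Q)) := by
  set S : Site 4 → ℝ := twoPointFree 4 β with hSdef
  have hSpos : ∀ z, 0 < S z := twoPointFree_pos_four hβ hβc
  have hS0 : ∀ z, 0 ≤ S z := fun z => (hSpos z).le
  have hβc0 : 0 < criticalBeta 4 := lt_of_lt_of_le hβ hβc
  -- basic size facts
  have hN1 : 1 ≤ N := le_trans Nat.one_le_two_pow hN
  have hN2 : 2 ≤ N := le_trans (by
    calc 2 = 2 ^ 1 := by norm_num
      _ ≤ 2 ^ (10000 * Q) := Nat.pow_le_pow_right (by norm_num) (by omega)) hN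
  have hNN : N - 1 + 1 = N := Nat.sub_add_cancel hN1
  have h16M : 16 * 2 ^ (1000 * Q) ≤ N := le_trans (by
    calc 16 * 2 ^ (1000 * Q) = 2 ^ (1000 * Q + 4) := by ring
      _ ≤ 2 ^ (10000 * Q) := Nat.pow_le_pow_right (by norm_num) (by omega)) hN
  have h16M' : 16 * 2 ^ (20 * Q) ≤ N := le_trans (Nat.mul_le_mul_left 16 (pow_grid_le (by norm_num))) h16M
  -- the top index family
  set I : ℕ → Finset (Site 4) := arbFamily (y - u) with hI
  have hfam : ∀ k ∈ 𝒦, arbFamily (y - u) k ⊆ ann 4 (2 ^ k) (2 * 2 ^ k) ∧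
      (1 / 4096 : ℝ) * (2 ^ k : ℝ) ^ 4 ≤ #(arbFamily (y - u) k) ∧
      (∀ v ∈ arbFamily (y - u) k, S (y - u) ≤ (1 + 0 * 2 ^ k / ((2 : ℝ) ^ (999 * Q))) * S (y - u - v)) ∧
      (∀ v ∈ arbFamily (y - u) k, ∀ p : Site 4, Site.supNorm p ≤ 2 ^ (100 * Q) → S (y - u - p) ≤ 1 * S (y - u - v)) := by
    intro k hk
    obtain ⟨hk1, hk2⟩ := h𝒦 k hk
    refine arbFamily_spec hβ.le (y - u) (k := k) (r := 2 ^ (100 * Q)) ?_ ?_ _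
    · calc 4 * 2 ^ k = 2 ^ (k + 2) := by ring
        _ ≤ 2 ^ (10000 * Q) := Nat.pow_le_pow_right (by norm_num) (by omega)
        _ ≤ Site.supNorm (y - u) := hN.trans hyN
    · rw [Nat.le_div_iff_mul_le (by norm_num)]
      calc 2 ^ (100 * Q) * 8 = 2 ^ (100 * Q + 3) := by ring
        _ ≤ 2 ^ k := Nat.pow_le_pow_right (by norm_num) (by omega)
  -- the lower bound `s_W` on the blocks
  have hsWv : ∀ {M : ℕ} (v : Site 4) (k : ℕ), v ∈ ann 4 (2 ^ k) (2 * 2 ^ k) → 2 * 2 ^ k ≤ M → 16 * M ≤ N →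
      Real.exp (-2) / (32 * criticalBeta 4) / (216 * (16 * (M : ℝ)) ^ 3) ≤ S v := by
    intro M v k hv hkM hMN
    rw [mem_ann] at hv
    have hv0 : v ≠ 0 := fun h => by
      rw [h, Site.supNorm_eq_zero_iff.2 rfl] at hv
      have := Nat.one_le_two_pow (n := k); omega
    exact twoPointFree_ge_uniform_of_window hβ hβc hN2 hwin hMN hv0 (hv.2.trans hkM)
  have hsWtop : ∀ k ∈ 𝒦, ∀ v ∈ I k,
      Real.exp (-2) / (32 * criticalBeta 4) / (216 * (16 * ((2 ^ (1000 * Q) : ℕ) : ℝ)) ^ 3) ≤ S v := by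
    intro k hk v hv
    refine hsWv v k ((hfam k hk).1 hv) ?_ h16M
    calc 2 * 2 ^ k = 2 ^ (k + 1) := by ring
      _ ≤ 2 ^ (1000 * Q) := Nat.pow_le_pow_right (by norm_num) (by have := (h𝒦 k hk).2; omega)
  have hsWlow : ∀ j ∈ 𝒦', ∀ v ∈ regFamily j,
      Real.exp (-2) / (32 * criticalBeta 4) / (216 * (16 * ((2 ^ (20 * Q) : ℕ) : ℝ)) ^ 3) ≤ S v := by
    intro j hj v hv
    refine hsWv v j (goodCube_subset_ann _ _ (by omega) hv) ?_ h16M'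
    calc 2 * 2 ^ j = 2 ^ (j + 1) := by ring
      _ ≤ 2 ^ (20 * Q) := Nat.pow_le_pow_right (by norm_num) (by have := (h𝒦' j hj).2; omega)
  have hsWpos : ∀ M : ℕ, 0 < Real.exp (-2) / (32 * criticalBeta 4) / (216 * (16 * (M + 1 : ℝ)) ^ 3) := fun M => by positivity
  have hsWpos' : ∀ M : ℕ, 1 ≤ M → 0 < Real.exp (-2) / (32 * criticalBeta 4) / (216 * (16 * (M : ℝ)) ^ 3) := fun M hM => by
    have : (0 : ℝ) < M := by exact_mod_cast hM
    positivity
  -- cardinalities and the losses `η = 1/|𝒦|`, `η' = 1/|𝒦'|`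
  have h𝒦ne : 𝒦.Nonempty := card_pos.1 (by omega)
  have h𝒦'ne : 𝒦'.Nonempty := card_pos.1 (by omega)
  have hη0 : (0 : ℝ) < 1 / #𝒦 := by positivity
  have hη1 : (1 : ℝ) / #𝒦 < 1 := by
    rw [div_lt_one (by positivity)]; exact_mod_cast (show 1 < #𝒦 by omega)
  have hη0' : (0 : ℝ) < 1 / #𝒦' := by positivity
  have hη1' : (1 : ℝ) / #𝒦' < 1 := by
    rw [div_lt_one (by positivity)]; exact_mod_cast (show 1 < #𝒦' by omega)
  -- (6.16) at the top level
  have hfar : N - 1 < Site.supNorm (y - u) := by omega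
  have hA := box_mixingCore_prob_eventually' hβ hβc hCIR hIR u y y 𝒦 I I (c := c₀) (C := C₀) (κ := 0)
    (Y := (2 : ℝ) ^ (999 * Q)) (γ := 1 / 4096) (η := 1 / #𝒦)
    (sW := Real.exp (-2) / (32 * criticalBeta 4) / (216 * (16 * ((2 ^ (1000 * Q) : ℕ) : ℝ)) ^ 3)) (θ := 1)
    hc₀ hC₀.le le_rfl (by norm_num) hη0 hη1 (hsWpos' _ Nat.one_le_two_pow) zero_le_one h𝒦ne hreg hsep
    (fun j hj => by exact_mod_cast Nat.pow_le_pow_right (show 1 ≤ 2 by norm_num) (h𝒦 j hj).2)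
    (fun k hk => (hfam k hk).1) (fun k hk => (hfam k hk).1) (fun k hk => (hfam k hk).2.1) (fun k hk => (hfam k hk).2.1)
    (fun k hk => (hfam k hk).2.2.1) (fun k hk => (hfam k hk).2.2.1)
    (n₀ := n) (r := 2 ^ (100 * Q)) (mℓ := 2 ^ (200 * Q)) (m₀ := 2 ^ (200 * Q) - 1) (M₃ := 2 ^ (1000 * Q))
    (R := 2 ^ (3100 * Q)) (N₄ := N - 1) hn
    (lt_of_lt_of_le hnQ (Nat.pow_le_pow_right (by norm_num) (by omega))) (pow_grid_lt hQ (by norm_num))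
    (by rw [Nat.sub_add_cancel Nat.one_le_two_pow]; exact pow_grid_le (by norm_num))
    (by have := lt_of_lt_of_le hnQ (Nat.pow_le_pow_right (show 1 ≤ 2 by norm_num) (show Q ≤ 200 * Q by omega)); omega)
    (le_trans (Nat.sub_le _ _) (pow_grid_le (by norm_num))) (pow_grid_lt hQ (by norm_num))
    (by have := pow_grid_lt (a := 3100) (b := 10000) hQ (by norm_num); omega)
    (fun j hj => Nat.pow_le_pow_right (by norm_num) (h𝒦 j hj).1)
    (fun j hj => by
      calc 2 * 2 ^ j = 2 ^ (j + 1) := by ring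
        _ ≤ 2 ^ (1000 * Q) := Nat.pow_le_pow_right (by norm_num) (by have := (h𝒦 j hj).2; omega))
    hfar hfar (fun k hk => (hfam k hk).2.2.2) (fun k hk => (hfam k hk).2.2.2) hsWtop hsWtop
  -- the switch points and the relocation (6.9) between all pairs of them
  set Ptop : Finset (Site 4) := 𝒦.biUnion fun k => (I k).image fun v => u + v with hPtop
  have hPtop_spec : ∀ p ∈ Ptop, ∃ k ∈ 𝒦, p - u ∈ I k := fun p hp => by
    rw [hPtop, mem_biUnion] at hp
    obtain ⟨k, hk, hp⟩ := hp
    rw [mem_image] at hp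
    obtain ⟨v, hv, rfl⟩ := hp
    exact ⟨k, hk, by rwa [add_sub_cancel_left]⟩
  have hOD : ∀ t ∈ (Ptop ×ˢ Ptop) ×ˢ (Ptop ×ˢ Ptop), ∀ᶠ L : ℕ in atTop,
      ∀ (hu : u ∈ box 4 L) (hq₁ : t.1.1 ∈ box 4 L) (hq₂ : t.1.2 ∈ box 4 L) (hq₁' : t.2.1 ∈ box 4 L) (hq₂' : t.2.2 ∈ box 4 L),
      ∀ Φ : FourCfg (boxGraph (box 4 L)) → ℝ≥0∞, (∀ pq, Φ pq ≤ 1) →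
        FourLocal (edgesWithin (G := boxGraph (box 4 L)) ⟨u, hu⟩ n) Φ →
        |srcProb (Kc (box 4 L) β) ({⟨u, hu⟩} ∆ {⟨t.1.1, hq₁⟩}) ({⟨u, hu⟩} ∆ {⟨t.1.2, hq₂⟩}) Φ -
          srcProb (Kc (box 4 L) β) ({⟨u, hu⟩} ∆ {⟨t.2.1, hq₁'⟩}) ({⟨u, hu⟩} ∆ {⟨t.2.2, hq₂'⟩}) Φ| ≤
        odErr c₀ C₀ CIR (1 / #𝒦') (Real.exp (-2) / (32 * criticalBeta 4) / (216 * (16 * ((2 ^ (20 * Q) : ℕ) : ℝ)) ^ 3))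
          (4 * C₀ * (2 ^ (20 * Q) : ℕ) / 2 ^ (200 * Q)) #𝒦' n (2 ^ (4 * Q)) (2 ^ (7 * Q)) (2 ^ (7 * Q) - 1)
          (2 ^ (20 * Q)) (2 ^ (64 * Q)) (2 ^ (196 * Q)) := by
    intro t ht
    simp only [mem_product] at ht
    obtain ⟨⟨h11, h12⟩, ⟨h21, h22⟩⟩ := ht
    obtain ⟨k₁, hk₁, hp₁⟩ := hPtop_spec _ h11
    obtain ⟨k₂, hk₂, hp₂⟩ := hPtop_spec _ h12
    obtain ⟨k₁', hk₁', hp₁'⟩ := hPtop_spec _ h21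
    obtain ⟨k₂', hk₂', hp₂'⟩ := hPtop_spec _ h22
    have hann : ∀ {k : ℕ} {p : Site 4}, k ∈ 𝒦 → p - u ∈ I k → p - u ∈ ann 4 (2 ^ k) (2 * 2 ^ k) :=
      fun {k p} hk hp => (hfam k hk).1 hp
    exact box_relocation_regular hβ hβc hCIR hIR u t.1.1 t.1.2 t.2.1 t.2.2 hc₀ hC₀.le (kf := 200 * Q)
      (hreg k₁ hk₁) (hreg k₂ hk₂) (hreg k₁' hk₁') (hreg k₂' hk₂') (hann hk₁ hp₁) (hann hk₂ hp₂) (hann hk₁' hp₁')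
      (hann hk₂' hp₂') (h𝒦 k₁ hk₁).1 (h𝒦 k₂ hk₂).1 (h𝒦 k₁' hk₁').1 (h𝒦 k₂' hk₂').1 𝒦' h𝒦'ne hreg' hsep'
      (fun j hj => by
        calc 4 * 2 ^ j = 2 ^ (j + 2) := by ring
          _ ≤ 2 ^ (200 * Q) := Nat.pow_le_pow_right (by norm_num) (by have := (h𝒦' j hj).2; omega))
      hη0' hη1' (hsWpos' _ Nat.one_le_two_pow) hsWlow (n₀ := n) (r := 2 ^ (4 * Q)) (mℓ := 2 ^ (7 * Q))
      (m₀ := 2 ^ (7 * Q) - 1) (M₃ := 2 ^ (20 * Q)) (R := 2 ^ (64 * Q)) (N₄ := 2 ^ (196 * Q)) hn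
      (lt_of_lt_of_le hnQ (Nat.pow_le_pow_right (by norm_num) (by omega))) (pow_grid_lt hQ (by norm_num))
      (by rw [Nat.sub_add_cancel Nat.one_le_two_pow]; exact pow_grid_le (by norm_num))
      (by have := lt_of_lt_of_le hnQ (Nat.pow_le_pow_right (show 1 ≤ 2 by norm_num) (show Q ≤ 7 * Q by omega)); omega)
      (le_trans (Nat.sub_le _ _) (pow_grid_le (by norm_num))) (pow_grid_lt hQ (by norm_num)) (pow_grid_le (by norm_num))
      (fun j hj => Nat.pow_le_pow_right (by norm_num) (h𝒦' j hj).1)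
      (fun j hj => by
        calc 2 * 2 ^ j = 2 ^ (j + 1) := by ring
          _ ≤ 2 ^ (20 * Q) := Nat.pow_le_pow_right (by norm_num) (by have := (h𝒦' j hj).2; omega))
      (by calc 2 * 2 ^ (4 * Q) = 2 ^ (4 * Q + 1) := by ring
            _ ≤ 2 ^ (200 * Q) := Nat.pow_le_pow_right (by norm_num) (by omega))
      (by calc 2 * 2 ^ (20 * Q) = 2 ^ (20 * Q + 1) := by ring
            _ ≤ 2 ^ (200 * Q) := Nat.pow_le_pow_right (by norm_num) (by omega))
      (pow_grid_lt hQ (by norm_num))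
  have hODall := (((Ptop ×ˢ Ptop) ×ˢ (Ptop ×ˢ Ptop)).eventually_all).2 hOD
  have hCmp := eventually_boxComparable hβ.le hη0 (mixPairs u y 𝒦 I)
  filter_upwards [hA, hODall, hCmp] with L hAL hODL hCL
  intro hu hy Φ Ψ hΦ1 hΨ1 hΦ hΨ
  have hK : ∀ e, 0 ≤ Kc (box 4 L) β e := fun _ => hβ.le
  obtain ⟨hu', hy', hIΛ, hlow_uy, hblk⟩ := hCL.mixPairs_spec
  set U : ↥(box 4 L) := ⟨u, hu⟩ with hU
  set Yv : ↥(box 4 L) := ⟨y, hy⟩ with hYv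
  set T : ↥(box 4 L) → ↥(box 4 L) → ℝ := boxTwoPt (box 4 L) β with hT
  have h1η : (0 : ℝ) < 1 - 1 / #𝒦 := by linarith
  have hZ : ∀ {a b : ↥(box 4 L)} {x : Site 4}, (1 - 1 / #𝒦) * S x ≤ T a b → ecurrentSum (Kc (box 4 L) β) ({a} ∆ {b}) ≠ 0 := by
    intro a b x h h0
    have hpos : 0 < T a b := lt_of_lt_of_le (mul_pos h1η (hSpos x)) h
    rw [hT, boxTwoPt_eq_div hβ.le, h0, ENNReal.toReal_zero, zero_div] at hpos
    exact lt_irrefl _ hpos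
  have hZuy : ecurrentSum (Kc (box 4 L) β) ({U} ∆ {Yv}) ≠ 0 := hZ hlow_uy
  have hNuy : srcNrm (Kc (box 4 L) β) ({U} ∆ {Yv}) ({U} ∆ {Yv}) ≠ 0 := by
    unfold srcNrm
    exact mul_ne_zero (mul_ne_zero (ecurrentSum_empty_ne_zero _) hZuy) (mul_ne_zero (ecurrentSum_empty_ne_zero _) hZuy)
  -- blocks, coefficients, switch weights
  have hblkmem : ∀ {j : ℕ} {v : ↥(box 4 L)}, v ∈ blk U I j ↔ ((v : Site 4) - u) ∈ I j := by
    intro j v; unfold blk; simp [hU]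
  have hblk_ne : ∀ j ∈ 𝒦, blkSum β U Yv I j ≠ 0 := by
    intro j hj
    have hne : (blk U I j).Nonempty := by
      rw [← Finset.card_pos]
      have h1 : (0 : ℝ) < #(I j) := lt_of_lt_of_le (by positivity) (hfam j hj).2.1
      rw [← card_blk_eq U I j (hIΛ j hj)] at h1
      exact_mod_cast h1
    obtain ⟨v, hv⟩ := hne
    unfold blkSum
    intro h0
    have := Finset.sum_eq_zero_iff.1 h0 v hv
    rcases mul_eq_zero.1 this with h | h
    · exact hZ (hblk j hj v hv).1 h
    · exact hZ (hblk j hj v hv).2 h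
  have hc := sum_mixCoeff_mul U Yv 𝒦 I hβ.le h𝒦ne hblk_ne
  have htop := mixCoeff_ne_top U Yv 𝒦 I hβ.le hblk_ne
  set sw : ↥(box 4 L) → ↥(box 4 L) → ℝ := fun v₁ v₂ =>
    switchWeight (Kc (box 4 L) β) U U Yv Yv (mixCoeff β U Yv 𝒦 I) (mixCoeff β U Yv 𝒦 I) v₁ v₂ with hsw
  have hsw0 : ∀ v₁ v₂, 0 ≤ sw v₁ v₂ := fun v₁ v₂ => switchWeight_nonneg _ _ _ _ _ _ _ _ _
  have hsw1 : ∑ v₁, ∑ v₂, sw v₁ v₂ = 1 := sum_switchWeight_eq_one hK U U Yv Yv htop htop hc hc hNuy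
  have hsupp : ∀ {v₁ v₂ : ↥(box 4 L)}, sw v₁ v₂ ≠ 0 →
      ((∃ k ∈ 𝒦, ((v₁ : Site 4) - u) ∈ I k) ∧ ∃ k ∈ 𝒦, ((v₂ : Site 4) - u) ∈ I k) := fun h =>
    switchWeight_ne_zero_imp U Yv Yv 𝒦 I I h
  -- normalisations on the support
  have hNin : ∀ {v₁ v₂ : ↥(box 4 L)}, sw v₁ v₂ ≠ 0 → srcNrm (Kc (box 4 L) β) ({U} ∆ {v₁}) ({U} ∆ {v₂}) ≠ 0 := by
    intro v₁ v₂ h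
    obtain ⟨⟨k₁, hk₁, hv₁⟩, ⟨k₂, hk₂, hv₂⟩⟩ := hsupp h
    unfold srcNrm
    exact mul_ne_zero (mul_ne_zero (ecurrentSum_empty_ne_zero _) (hZ (hblk k₁ hk₁ v₁ (hblkmem.2 hv₁)).1))
      (mul_ne_zero (ecurrentSum_empty_ne_zero _) (hZ (hblk k₂ hk₂ v₂ (hblkmem.2 hv₂)).1))
  have hNout : ∀ {v₁ v₂ : ↥(box 4 L)}, sw v₁ v₂ ≠ 0 → srcNrm (Kc (box 4 L) β) ({v₁} ∆ {Yv}) ({v₂} ∆ {Yv}) ≠ 0 := by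
    intro v₁ v₂ h
    obtain ⟨⟨k₁, hk₁, hv₁⟩, ⟨k₂, hk₂, hv₂⟩⟩ := hsupp h
    unfold srcNrm
    exact mul_ne_zero (mul_ne_zero (ecurrentSum_empty_ne_zero _) (hZ (hblk k₁ hk₁ v₁ (hblkmem.2 hv₁)).2))
      (mul_ne_zero (ecurrentSum_empty_ne_zero _) (hZ (hblk k₂ hk₂ v₂ (hblkmem.2 hv₂)).2))
  -- the functionals of the switch points
  set f : ↥(box 4 L) → ↥(box 4 L) → ℝ := fun v₁ v₂ => srcProb (Kc (box 4 L) β) ({U} ∆ {v₁}) ({U} ∆ {v₂}) Φ with hf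
  set g : ↥(box 4 L) → ↥(box 4 L) → ℝ := fun v₁ v₂ => srcProb (Kc (box 4 L) β) ({v₁} ∆ {Yv}) ({v₂} ∆ {Yv}) Ψ with hg
  have hf0 : ∀ v₁ v₂, 0 ≤ f v₁ v₂ := fun _ _ => srcProb_nonneg _ _ _ _
  have hf1 : ∀ v₁ v₂, f v₁ v₂ ≤ 1 := fun _ _ => srcProb_le_one hK _ _ hΦ1
  have hg0 : ∀ v₁ v₂, 0 ≤ g v₁ v₂ := fun _ _ => srcProb_nonneg _ _ _ _
  have hg1 : ∀ v₁ v₂, g v₁ v₂ ≤ 1 := fun _ _ => srcProb_le_one hK _ _ hΨ1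
  -- the three instances of (6.16)
  have hΨ' : FourLocal (edgesBeyond (G := boxGraph (box 4 L)) ⟨u, hu⟩ (N - 1 + 1)) Ψ := by rwa [hNN]
  have h1loc : FourLocal (edgesWithin (G := boxGraph (box 4 L)) ⟨u, hu⟩ n) (fun _ : FourCfg (boxGraph (box 4 L)) => (1 : ℝ≥0∞)) :=
    fourLocal_const _ 1
  have h1loc' : FourLocal (edgesBeyond (G := boxGraph (box 4 L)) ⟨u, hu⟩ (N - 1 + 1)) (fun _ : FourCfg (boxGraph (box 4 L)) => (1 : ℝ≥0∞)) :=
    fourLocal_const _ 1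
  have hA1 := hAL hu hy hy Φ Ψ hΦ1 hΨ1 hΦ hΨ'
  have hA2 := hAL hu hy hy Φ (fun _ => 1) hΦ1 (fun _ => le_rfl) hΦ h1loc'
  have hA3 := hAL hu hy hy (fun _ => 1) Ψ (fun _ => le_rfl) hΨ1 h1loc hΨ'
  have hΦmul : Φ * (fun _ => (1 : ℝ≥0∞)) = Φ := by funext x; simp
  have hmulΨ : (fun _ => (1 : ℝ≥0∞)) * Ψ = Ψ := by funext x; simp
  rw [hΦmul] at hA2
  rw [hmulΨ] at hA3
  -- simplify the sums of `hA2`, `hA3` using `P[1] = 1` on the support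
  have hsum2 : ∑ v₁, ∑ v₂, sw v₁ v₂ * (f v₁ v₂ * srcProb (Kc (box 4 L) β) ({v₁} ∆ {Yv}) ({v₂} ∆ {Yv}) (fun _ => 1)) =
      ∑ v₁, ∑ v₂, sw v₁ v₂ * f v₁ v₂ := by
    refine Finset.sum_congr rfl fun v₁ _ => Finset.sum_congr rfl fun v₂ _ => ?_
    by_cases h0 : sw v₁ v₂ = 0
    · rw [h0, zero_mul, zero_mul]
    · rw [srcProb_one hK (hNout h0), mul_one]
  have hsum3 : ∑ v₁, ∑ v₂, sw v₁ v₂ * (srcProb (Kc (box 4 L) β) ({U} ∆ {v₁}) ({U} ∆ {v₂}) (fun _ => 1) * g v₁ v₂) =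
      ∑ v₁, ∑ v₂, sw v₁ v₂ * g v₁ v₂ := by
    refine Finset.sum_congr rfl fun v₁ _ => Finset.sum_congr rfl fun v₂ _ => ?_
    by_cases h0 : sw v₁ v₂ = 0
    · rw [h0, zero_mul, zero_mul]
    · rw [srcProb_one hK (hNin h0), one_mul]
  rw [hsum2] at hA2
  rw [hsum3] at hA3
  -- pass to sums over `V × V`
  have hnest : ∀ F : ↥(box 4 L) → ↥(box 4 L) → ℝ, ∑ x : ↥(box 4 L) × ↥(box 4 L), sw x.1 x.2 * F x.1 x.2 =
      ∑ v₁, ∑ v₂, sw v₁ v₂ * F v₁ v₂ := fun F => Fintype.sum_prod_type _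
  have hδ1 : ∑ x : ↥(box 4 L) × ↥(box 4 L), sw x.1 x.2 = 1 := by rw [Fintype.sum_prod_type]; exact hsw1
  rw [← hnest (fun v₁ v₂ => f v₁ v₂ * g v₁ v₂)] at hA1
  rw [← hnest f] at hA2
  rw [← hnest g] at hA3
  -- (6.20): the inside functional is insensitive to the switch point
  set ε₂ : ℝ := odErr c₀ C₀ CIR (1 / #𝒦') (Real.exp (-2) / (32 * criticalBeta 4) / (216 * (16 * ((2 ^ (20 * Q) : ℕ) : ℝ)) ^ 3))
      (4 * C₀ * (2 ^ (20 * Q) : ℕ) / 2 ^ (200 * Q)) #𝒦' n (2 ^ (4 * Q)) (2 ^ (7 * Q)) (2 ^ (7 * Q) - 1)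
      (2 ^ (20 * Q)) (2 ^ (64 * Q)) (2 ^ (196 * Q)) with hε₂
  have hod : ∀ x x' : ↥(box 4 L) × ↥(box 4 L), sw x.1 x.2 ≠ 0 → sw x'.1 x'.2 ≠ 0 → |f x.1 x.2 - f x'.1 x'.2| ≤ ε₂ := by
    intro x x' hx hx'
    obtain ⟨⟨k₁, hk₁, hv₁⟩, ⟨k₂, hk₂, hv₂⟩⟩ := hsupp hx
    obtain ⟨⟨k₁', hk₁', hv₁'⟩, ⟨k₂', hk₂', hv₂'⟩⟩ := hsupp hx'
    have hmem : ∀ {v : ↥(box 4 L)} {k : ℕ}, k ∈ 𝒦 → ((v : Site 4) - u) ∈ I k → (v : Site 4) ∈ Ptop := by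
      intro v k hk hv
      rw [hPtop, mem_biUnion]
      exact ⟨k, hk, mem_image.2 ⟨(v : Site 4) - u, hv, by abel⟩⟩
    have ht : ((((x.1 : ↥(box 4 L)) : Site 4), ((x.2 : ↥(box 4 L)) : Site 4)), (((x'.1 : ↥(box 4 L)) : Site 4), ((x'.2 : ↥(box 4 L)) : Site 4))) ∈
        (Ptop ×ˢ Ptop) ×ˢ (Ptop ×ˢ Ptop) := by
      simp only [mem_product]
      exact ⟨⟨hmem hk₁ hv₁, hmem hk₂ hv₂⟩, ⟨hmem hk₁' hv₁', hmem hk₂' hv₂'⟩⟩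
    have h := hODL _ ht hu x.1.2 x.2.2 x'.1.2 x'.2.2 Φ hΦ1 hΦ
    exact h
  set PΦ : ℝ := srcProb (Kc (box 4 L) β) ({U} ∆ {Yv}) ({U} ∆ {Yv}) Φ with hPΦ
  set PΨ : ℝ := srcProb (Kc (box 4 L) β) ({U} ∆ {Yv}) ({U} ∆ {Yv}) Ψ with hPΨ
  have hpivot : ∀ x ∈ (univ : Finset (↥(box 4 L) × ↥(box 4 L))), sw x.1 x.2 ≠ 0 →
      |f x.1 x.2 - PΦ| ≤ (concErr c₀ C₀ 0 (1 / 4096) (1 / #𝒦) #𝒦 +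
          splitErr CIR (1 / #𝒦) (Real.exp (-2) / (32 * criticalBeta 4) / (216 * (16 * ((2 ^ (1000 * Q) : ℕ) : ℝ)) ^ 3)) 1 n
            (2 ^ (100 * Q)) (2 ^ (200 * Q)) (2 ^ (200 * Q) - 1) (2 ^ (1000 * Q)) (2 ^ (3100 * Q)) (N - 1)) + ε₂ := by
    intro x _ hx
    rw [abs_sub_comm]
    exact abs_sub_le_of_switch_pivot (univ : Finset (↥(box 4 L) × ↥(box 4 L))) (δ := fun z => sw z.1 z.2)
      (f := fun z => f z.1 z.2) (fun z _ => hsw0 _ _) hδ1 hA2 (fun z _ hz => hod z x hz hx)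
  have hmain := abs_sub_mul_le_of_switch' (univ : Finset (↥(box 4 L) × ↥(box 4 L))) (δ := fun z => sw z.1 z.2)
    (f := fun z => f z.1 z.2) (g := fun z => g z.1 z.2) (P := srcProb (Kc (box 4 L) β) ({U} ∆ {Yv}) ({U} ∆ {Yv}) (Φ * Ψ))
    (PE := PΦ) (PF := PΨ) (fun z _ => hsw0 _ _) hδ1 hA1 hpivot hA3 (fun z _ => hg0 _ _) (fun z _ => hg1 _ _)
    (srcProb_nonneg _ _ _ _) (srcProb_le_one hK _ _ hΦ1)
  refine hmain.trans (le_of_eq ?_)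
  ring

set_option maxHeartbeats 2000000 in
open Classical in
/-- **(6.9) on `Λ_L`, `t = 2`, centre sources, arbitrary far sources `(x,z)` versus `(y,y)`, at a fixed grid
parameter `Q`**: for all large `L`, `|P^{ux,uz}_{Λ_L}[Φ] - P^{uy,uy}_{Λ_L}[Φ]| ≤ 2ε₁ + 2ε₂` — (6.16) with the full outside
event for both pairs of far sources, and the regular-case relocation between the switch points ("We also pick `𝐲` on
which we do not assume anything. The fact that the `δ(𝐮,𝐱,𝐲)` sum to 1 implies that …", p. 26).
[cite: AizenmanDuminilCopinAnnals2021, arXiv:1912.07973 §6.2, proof of Thm 6.4, (6.20) and the general case of (6.9) (p. 26)] -/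
theorem relocation_at_scale {β : ℝ} (hβ : 0 < β) (hβc : β ≤ criticalBeta 4) {CIR : ℝ} (hCIR : 0 ≤ CIR)
    (hIR : ∀ x : Site 4, x ≠ 0 → twoPointFree 4 β x ≤ CIR / (Site.supNorm x : ℝ) ^ 2)
    (u xf zf y : Site 4) {c₀ C₀ : ℝ} (hc₀ : 0 < c₀) (hC₀ : 0 < C₀) (𝒦 𝒦' : Finset ℕ) {Q n N : ℕ}
    (hQ : 1 ≤ Q) (hn : 1 ≤ n) (hnQ : n < 2 ^ Q) (hN : 2 ^ (10000 * Q) ≤ N)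
    (hwin : β = criticalBeta 4 ∨ (0 < β ∧ (N : ℝ) * invCorrLength (twoPointPlus 4 β) ≤ 1))
    (hxN : N ≤ Site.supNorm (xf - u)) (hzN : N ≤ Site.supNorm (zf - u)) (hyN : N ≤ Site.supNorm (y - u))
    (h𝒦 : ∀ k ∈ 𝒦, 200 * Q ≤ k ∧ k ≤ 999 * Q) (hreg : ∀ k ∈ 𝒦, IsRegularScale (twoPointFree 4 β) c₀ C₀ (2 ^ k))
    (hsep : ∀ k ∈ 𝒦, ∀ k' ∈ 𝒦, k < k' → (C₀ + 2) * 2 ^ k < (2 ^ k' : ℝ)) (hcard : 10 ≤ #𝒦)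
    (h𝒦' : ∀ j ∈ 𝒦', 7 * Q ≤ j ∧ j ≤ 19 * Q) (hreg' : ∀ j ∈ 𝒦', IsRegularScale (twoPointFree 4 β) c₀ C₀ (2 ^ j))
    (hsep' : ∀ j ∈ 𝒦', ∀ j' ∈ 𝒦', j < j' → (C₀ + 2) * 2 ^ j < (2 ^ j' : ℝ)) (hcard' : 10 ≤ #𝒦') :
    ∀ᶠ L : ℕ in atTop, ∀ (hu : u ∈ box 4 L) (hx : xf ∈ box 4 L) (hz : zf ∈ box 4 L) (hy : y ∈ box 4 L),
      ∀ Φ : FourCfg (boxGraph (box 4 L)) → ℝ≥0∞, (∀ pq, Φ pq ≤ 1) →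
        FourLocal (edgesWithin (G := boxGraph (box 4 L)) ⟨u, hu⟩ n) Φ →
        |srcProb (Kc (box 4 L) β) ({⟨u, hu⟩} ∆ {⟨xf, hx⟩}) ({⟨u, hu⟩} ∆ {⟨zf, hz⟩}) Φ -
          srcProb (Kc (box 4 L) β) ({⟨u, hu⟩} ∆ {⟨y, hy⟩}) ({⟨u, hu⟩} ∆ {⟨y, hy⟩}) Φ| ≤
        2 * (concErr c₀ C₀ 0 (1 / 4096) (1 / #𝒦) #𝒦 +
              splitErr CIR (1 / #𝒦) (Real.exp (-2) / (32 * criticalBeta 4) / (216 * (16 * ((2 ^ (1000 * Q) : ℕ) : ℝ)) ^ 3)) 1 n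
                (2 ^ (100 * Q)) (2 ^ (200 * Q)) (2 ^ (200 * Q) - 1) (2 ^ (1000 * Q)) (2 ^ (3100 * Q)) (N - 1)) +
          2 * odErr c₀ C₀ CIR (1 / #𝒦') (Real.exp (-2) / (32 * criticalBeta 4) / (216 * (16 * ((2 ^ (20 * Q) : ℕ) : ℝ)) ^ 3))
            (4 * C₀ * (2 ^ (20 * Q) : ℕ) / 2 ^ (200 * Q)) #𝒦' n (2 ^ (4 * Q)) (2 ^ (7 * Q)) (2 ^ (7 * Q) - 1)
            (2 ^ (20 * Q)) (2 ^ (64 * Q)) (2 ^ (196 * Q)) := by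
  set S : Site 4 → ℝ := twoPointFree 4 β with hSdef
  have hSpos : ∀ z, 0 < S z := twoPointFree_pos_four hβ hβc
  have hS0 : ∀ z, 0 ≤ S z := fun z => (hSpos z).le
  have hβc0 : 0 < criticalBeta 4 := lt_of_lt_of_le hβ hβc
  have hN1 : 1 ≤ N := le_trans Nat.one_le_two_pow hN
  have hN2 : 2 ≤ N := le_trans (by
    calc 2 = 2 ^ 1 := by norm_num
      _ ≤ 2 ^ (10000 * Q) := Nat.pow_le_pow_right (by norm_num) (by omega)) hN
  have hNN : N - 1 + 1 = N := Nat.sub_add_cancel hN1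
  have h16M : 16 * 2 ^ (1000 * Q) ≤ N := le_trans (by
    calc 16 * 2 ^ (1000 * Q) = 2 ^ (1000 * Q + 4) := by ring
      _ ≤ 2 ^ (10000 * Q) := Nat.pow_le_pow_right (by norm_num) (by omega)) hN
  have h16M' : 16 * 2 ^ (20 * Q) ≤ N := le_trans (Nat.mul_le_mul_left 16 (pow_grid_le (by norm_num))) h16M
  -- index families of the three far points
  have hfam : ∀ {q : Site 4}, N ≤ Site.supNorm (q - u) → ∀ k ∈ 𝒦, arbFamily (q - u) k ⊆ ann 4 (2 ^ k) (2 * 2 ^ k) ∧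
      (1 / 4096 : ℝ) * (2 ^ k : ℝ) ^ 4 ≤ #(arbFamily (q - u) k) ∧
      (∀ v ∈ arbFamily (q - u) k, S (q - u) ≤ (1 + 0 * 2 ^ k / ((2 : ℝ) ^ (999 * Q))) * S (q - u - v)) ∧
      (∀ v ∈ arbFamily (q - u) k, ∀ p : Site 4, Site.supNorm p ≤ 2 ^ (100 * Q) → S (q - u - p) ≤ 1 * S (q - u - v)) := by
    intro q hqN k hk
    obtain ⟨hk1, hk2⟩ := h𝒦 k hk
    refine arbFamily_spec hβ.le (q - u) (k := k) (r := 2 ^ (100 * Q)) ?_ ?_ _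
    · calc 4 * 2 ^ k = 2 ^ (k + 2) := by ring
        _ ≤ 2 ^ (10000 * Q) := Nat.pow_le_pow_right (by norm_num) (by omega)
        _ ≤ Site.supNorm (q - u) := hN.trans hqN
    · rw [Nat.le_div_iff_mul_le (by norm_num)]
      calc 2 ^ (100 * Q) * 8 = 2 ^ (100 * Q + 3) := by ring
        _ ≤ 2 ^ k := Nat.pow_le_pow_right (by norm_num) (by omega)
  have hsWv : ∀ {M : ℕ} (v : Site 4) (k : ℕ), v ∈ ann 4 (2 ^ k) (2 * 2 ^ k) → 2 * 2 ^ k ≤ M → 16 * M ≤ N →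
      Real.exp (-2) / (32 * criticalBeta 4) / (216 * (16 * (M : ℝ)) ^ 3) ≤ S v := by
    intro M v k hv hkM hMN
    rw [mem_ann] at hv
    have hv0 : v ≠ 0 := fun h => by
      rw [h, Site.supNorm_eq_zero_iff.2 rfl] at hv
      have := Nat.one_le_two_pow (n := k); omega
    exact twoPointFree_ge_uniform_of_window hβ hβc hN2 hwin hMN hv0 (hv.2.trans hkM)
  have hsWtop : ∀ {q : Site 4}, N ≤ Site.supNorm (q - u) → ∀ k ∈ 𝒦, ∀ v ∈ arbFamily (q - u) k,
      Real.exp (-2) / (32 * criticalBeta 4) / (216 * (16 * ((2 ^ (1000 * Q) : ℕ) : ℝ)) ^ 3) ≤ S v := by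
    intro q hqN k hk v hv
    refine hsWv v k ((hfam hqN k hk).1 hv) ?_ h16M
    calc 2 * 2 ^ k = 2 ^ (k + 1) := by ring
      _ ≤ 2 ^ (1000 * Q) := Nat.pow_le_pow_right (by norm_num) (by have := (h𝒦 k hk).2; omega)
  have hsWlow : ∀ j ∈ 𝒦', ∀ v ∈ regFamily j,
      Real.exp (-2) / (32 * criticalBeta 4) / (216 * (16 * ((2 ^ (20 * Q) : ℕ) : ℝ)) ^ 3) ≤ S v := by
    intro j hj v hv
    refine hsWv v j (goodCube_subset_ann _ _ (by omega) hv) ?_ h16M'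
    calc 2 * 2 ^ j = 2 ^ (j + 1) := by ring
      _ ≤ 2 ^ (20 * Q) := Nat.pow_le_pow_right (by norm_num) (by have := (h𝒦' j hj).2; omega)
  have hsWpos' : ∀ M : ℕ, 1 ≤ M → 0 < Real.exp (-2) / (32 * criticalBeta 4) / (216 * (16 * (M : ℝ)) ^ 3) := fun M hM => by
    have : (0 : ℝ) < M := by exact_mod_cast hM
    positivity
  have h𝒦ne : 𝒦.Nonempty := card_pos.1 (by omega)
  have h𝒦'ne : 𝒦'.Nonempty := card_pos.1 (by omega)
  have hη0 : (0 : ℝ) < 1 / #𝒦 := by positivity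
  have hη1 : (1 : ℝ) / #𝒦 < 1 := by
    rw [div_lt_one (by positivity)]; exact_mod_cast (show 1 < #𝒦 by omega)
  have hη0' : (0 : ℝ) < 1 / #𝒦' := by positivity
  have hη1' : (1 : ℝ) / #𝒦' < 1 := by
    rw [div_lt_one (by positivity)]; exact_mod_cast (show 1 < #𝒦' by omega)
  -- (6.16) for a pair of arbitrary far sources
  have hAgen : ∀ {q₁ q₂ : Site 4} (hq₁N : N ≤ Site.supNorm (q₁ - u)) (hq₂N : N ≤ Site.supNorm (q₂ - u)),
      ∀ᶠ L : ℕ in atTop, ∀ (hu : u ∈ box 4 L) (hy₁ : q₁ ∈ box 4 L) (hy₂ : q₂ ∈ box 4 L),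
      ∀ Φ Ψ : FourCfg (boxGraph (box 4 L)) → ℝ≥0∞, (∀ pq, Φ pq ≤ 1) → (∀ pq, Ψ pq ≤ 1) →
        FourLocal (edgesWithin (G := boxGraph (box 4 L)) ⟨u, hu⟩ n) Φ →
        FourLocal (edgesBeyond (G := boxGraph (box 4 L)) ⟨u, hu⟩ (N - 1 + 1)) Ψ →
        |srcProb (Kc (box 4 L) β) ({⟨u, hu⟩} ∆ {⟨q₁, hy₁⟩}) ({⟨u, hu⟩} ∆ {⟨q₂, hy₂⟩}) (Φ * Ψ) -
          ∑ v₁, ∑ v₂, switchWeight (Kc (box 4 L) β) ⟨u, hu⟩ ⟨u, hu⟩ ⟨q₁, hy₁⟩ ⟨q₂, hy₂⟩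
              (mixCoeff β ⟨u, hu⟩ ⟨q₁, hy₁⟩ 𝒦 (arbFamily (q₁ - u))) (mixCoeff β ⟨u, hu⟩ ⟨q₂, hy₂⟩ 𝒦 (arbFamily (q₂ - u))) v₁ v₂ *
            (srcProb (Kc (box 4 L) β) ({⟨u, hu⟩} ∆ {v₁}) ({⟨u, hu⟩} ∆ {v₂}) Φ *
              srcProb (Kc (box 4 L) β) ({v₁} ∆ {⟨q₁, hy₁⟩}) ({v₂} ∆ {⟨q₂, hy₂⟩}) Ψ)| ≤
        concErr c₀ C₀ 0 (1 / 4096) (1 / #𝒦) #𝒦 +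
          splitErr CIR (1 / #𝒦) (Real.exp (-2) / (32 * criticalBeta 4) / (216 * (16 * ((2 ^ (1000 * Q) : ℕ) : ℝ)) ^ 3)) 1 n
            (2 ^ (100 * Q)) (2 ^ (200 * Q)) (2 ^ (200 * Q) - 1) (2 ^ (1000 * Q)) (2 ^ (3100 * Q)) (N - 1) := by
    intro q₁ q₂ hq₁N hq₂N
    have hfar₁ : N - 1 < Site.supNorm (q₁ - u) := by omega
    have hfar₂ : N - 1 < Site.supNorm (q₂ - u) := by omega
    exact box_mixingCore_prob_eventually' hβ hβc hCIR hIR u q₁ q₂ 𝒦 (arbFamily (q₁ - u)) (arbFamily (q₂ - u))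
      (c := c₀) (C := C₀) (κ := 0) (Y := (2 : ℝ) ^ (999 * Q)) (γ := 1 / 4096) (η := 1 / #𝒦)
      (sW := Real.exp (-2) / (32 * criticalBeta 4) / (216 * (16 * ((2 ^ (1000 * Q) : ℕ) : ℝ)) ^ 3)) (θ := 1)
      hc₀ hC₀.le le_rfl (by norm_num) hη0 hη1 (hsWpos' _ Nat.one_le_two_pow) zero_le_one h𝒦ne hreg hsep
      (fun j hj => by exact_mod_cast Nat.pow_le_pow_right (show 1 ≤ 2 by norm_num) (h𝒦 j hj).2)
      (fun k hk => (hfam hq₁N k hk).1) (fun k hk => (hfam hq₂N k hk).1) (fun k hk => (hfam hq₁N k hk).2.1)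
      (fun k hk => (hfam hq₂N k hk).2.1) (fun k hk => (hfam hq₁N k hk).2.2.1) (fun k hk => (hfam hq₂N k hk).2.2.1)
      (n₀ := n) (r := 2 ^ (100 * Q)) (mℓ := 2 ^ (200 * Q)) (m₀ := 2 ^ (200 * Q) - 1) (M₃ := 2 ^ (1000 * Q))
      (R := 2 ^ (3100 * Q)) (N₄ := N - 1) hn
      (lt_of_lt_of_le hnQ (Nat.pow_le_pow_right (by norm_num) (by omega))) (pow_grid_lt hQ (by norm_num))
      (by rw [Nat.sub_add_cancel Nat.one_le_two_pow]; exact pow_grid_le (by norm_num))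
      (by have := lt_of_lt_of_le hnQ (Nat.pow_le_pow_right (show 1 ≤ 2 by norm_num) (show Q ≤ 200 * Q by omega)); omega)
      (le_trans (Nat.sub_le _ _) (pow_grid_le (by norm_num))) (pow_grid_lt hQ (by norm_num))
      (by have := pow_grid_lt (a := 3100) (b := 10000) hQ (by norm_num); omega)
      (fun j hj => Nat.pow_le_pow_right (by norm_num) (h𝒦 j hj).1)
      (fun j hj => by
        calc 2 * 2 ^ j = 2 ^ (j + 1) := by ring
          _ ≤ 2 ^ (1000 * Q) := Nat.pow_le_pow_right (by norm_num) (by have := (h𝒦 j hj).2; omega))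
      hfar₁ hfar₂ (fun k hk => (hfam hq₁N k hk).2.2.2) (fun k hk => (hfam hq₂N k hk).2.2.2) (hsWtop hq₁N) (hsWtop hq₂N)
  have hAxz := hAgen hxN hzN
  have hAyy := hAgen hyN hyN
  -- all switch points of the three families, and the relocation between them
  set Pof : Site 4 → Finset (Site 4) := fun q => 𝒦.biUnion fun k => (arbFamily (q - u) k).image fun v => u + v with hPof
  set Pall : Finset (Site 4) := Pof xf ∪ Pof zf ∪ Pof y with hPall
  have hPof_spec : ∀ {q p : Site 4}, p ∈ Pof q → ∃ k ∈ 𝒦, p - u ∈ arbFamily (q - u) k := fun {q p} hp => by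
    rw [hPof, mem_biUnion] at hp
    obtain ⟨k, hk, hp⟩ := hp
    rw [mem_image] at hp
    obtain ⟨v, hv, rfl⟩ := hp
    exact ⟨k, hk, by rwa [add_sub_cancel_left]⟩
  have hPall_spec : ∀ p ∈ Pall, ∃ k ∈ 𝒦, p - u ∈ ann 4 (2 ^ k) (2 * 2 ^ k) := by
    intro p hp
    rw [hPall, mem_union, mem_union] at hp
    rcases hp with (hp | hp) | hp
    · obtain ⟨k, hk, h⟩ := hPof_spec hp; exact ⟨k, hk, (hfam hxN k hk).1 h⟩
    · obtain ⟨k, hk, h⟩ := hPof_spec hp; exact ⟨k, hk, (hfam hzN k hk).1 h⟩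
    · obtain ⟨k, hk, h⟩ := hPof_spec hp; exact ⟨k, hk, (hfam hyN k hk).1 h⟩
  have hOD : ∀ t ∈ (Pall ×ˢ Pall) ×ˢ (Pall ×ˢ Pall), ∀ᶠ L : ℕ in atTop,
      ∀ (hu : u ∈ box 4 L) (hq₁ : t.1.1 ∈ box 4 L) (hq₂ : t.1.2 ∈ box 4 L) (hq₁' : t.2.1 ∈ box 4 L) (hq₂' : t.2.2 ∈ box 4 L),
      ∀ Φ : FourCfg (boxGraph (box 4 L)) → ℝ≥0∞, (∀ pq, Φ pq ≤ 1) →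
        FourLocal (edgesWithin (G := boxGraph (box 4 L)) ⟨u, hu⟩ n) Φ →
        |srcProb (Kc (box 4 L) β) ({⟨u, hu⟩} ∆ {⟨t.1.1, hq₁⟩}) ({⟨u, hu⟩} ∆ {⟨t.1.2, hq₂⟩}) Φ -
          srcProb (Kc (box 4 L) β) ({⟨u, hu⟩} ∆ {⟨t.2.1, hq₁'⟩}) ({⟨u, hu⟩} ∆ {⟨t.2.2, hq₂'⟩}) Φ| ≤
        odErr c₀ C₀ CIR (1 / #𝒦') (Real.exp (-2) / (32 * criticalBeta 4) / (216 * (16 * ((2 ^ (20 * Q) : ℕ) : ℝ)) ^ 3))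
          (4 * C₀ * (2 ^ (20 * Q) : ℕ) / 2 ^ (200 * Q)) #𝒦' n (2 ^ (4 * Q)) (2 ^ (7 * Q)) (2 ^ (7 * Q) - 1)
          (2 ^ (20 * Q)) (2 ^ (64 * Q)) (2 ^ (196 * Q)) := by
    intro t ht
    simp only [mem_product] at ht
    obtain ⟨⟨h11, h12⟩, ⟨h21, h22⟩⟩ := ht
    obtain ⟨k₁, hk₁, hp₁⟩ := hPall_spec _ h11
    obtain ⟨k₂, hk₂, hp₂⟩ := hPall_spec _ h12
    obtain ⟨k₁', hk₁', hp₁'⟩ := hPall_spec _ h21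
    obtain ⟨k₂', hk₂', hp₂'⟩ := hPall_spec _ h22
    exact box_relocation_regular hβ hβc hCIR hIR u t.1.1 t.1.2 t.2.1 t.2.2 hc₀ hC₀.le (kf := 200 * Q)
      (hreg k₁ hk₁) (hreg k₂ hk₂) (hreg k₁' hk₁') (hreg k₂' hk₂') hp₁ hp₂ hp₁' hp₂'
      (h𝒦 k₁ hk₁).1 (h𝒦 k₂ hk₂).1 (h𝒦 k₁' hk₁').1 (h𝒦 k₂' hk₂').1 𝒦' h𝒦'ne hreg' hsep'
      (fun j hj => by
        calc 4 * 2 ^ j = 2 ^ (j + 2) := by ring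
          _ ≤ 2 ^ (200 * Q) := Nat.pow_le_pow_right (by norm_num) (by have := (h𝒦' j hj).2; omega))
      hη0' hη1' (hsWpos' _ Nat.one_le_two_pow) hsWlow (n₀ := n) (r := 2 ^ (4 * Q)) (mℓ := 2 ^ (7 * Q))
      (m₀ := 2 ^ (7 * Q) - 1) (M₃ := 2 ^ (20 * Q)) (R := 2 ^ (64 * Q)) (N₄ := 2 ^ (196 * Q)) hn
      (lt_of_lt_of_le hnQ (Nat.pow_le_pow_right (by norm_num) (by omega))) (pow_grid_lt hQ (by norm_num))
      (by rw [Nat.sub_add_cancel Nat.one_le_two_pow]; exact pow_grid_le (by norm_num))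
      (by have := lt_of_lt_of_le hnQ (Nat.pow_le_pow_right (show 1 ≤ 2 by norm_num) (show Q ≤ 7 * Q by omega)); omega)
      (le_trans (Nat.sub_le _ _) (pow_grid_le (by norm_num))) (pow_grid_lt hQ (by norm_num)) (pow_grid_le (by norm_num))
      (fun j hj => Nat.pow_le_pow_right (by norm_num) (h𝒦' j hj).1)
      (fun j hj => by
        calc 2 * 2 ^ j = 2 ^ (j + 1) := by ring
          _ ≤ 2 ^ (20 * Q) := Nat.pow_le_pow_right (by norm_num) (by have := (h𝒦' j hj).2; omega))
      (by calc 2 * 2 ^ (4 * Q) = 2 ^ (4 * Q + 1) := by ring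
            _ ≤ 2 ^ (200 * Q) := Nat.pow_le_pow_right (by norm_num) (by omega))
      (by calc 2 * 2 ^ (20 * Q) = 2 ^ (20 * Q + 1) := by ring
            _ ≤ 2 ^ (200 * Q) := Nat.pow_le_pow_right (by norm_num) (by omega))
      (pow_grid_lt hQ (by norm_num))
  have hODall := (((Pall ×ˢ Pall) ×ˢ (Pall ×ˢ Pall)).eventually_all).2 hOD
  have hCmp := eventually_boxComparable hβ.le hη0
    ((mixPairs u xf 𝒦 (arbFamily (xf - u)) ∪ mixPairs u zf 𝒦 (arbFamily (zf - u))) ∪ mixPairs u y 𝒦 (arbFamily (y - u)))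
  filter_upwards [hAxz, hAyy, hODall, hCmp] with L hAL hBL hODL hCL
  intro hu hx hz hy Φ hΦ1 hΦ
  have hK : ∀ e, 0 ≤ Kc (box 4 L) β e := fun _ => hβ.le
  obtain ⟨hu₁, hx', hIΛx, hlow_ux, hblkx⟩ := (hCL.mono (subset_union_left.trans subset_union_left)).mixPairs_spec
  obtain ⟨hu₂, hz', hIΛz, hlow_uz, hblkz⟩ := (hCL.mono (subset_union_right.trans subset_union_left)).mixPairs_spec
  obtain ⟨hu₃, hy', hIΛy, hlow_uy, hblky⟩ := (hCL.mono subset_union_right).mixPairs_spec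
  set U : ↥(box 4 L) := ⟨u, hu⟩ with hU
  set Xv : ↥(box 4 L) := ⟨xf, hx⟩ with hXv
  set Zv : ↥(box 4 L) := ⟨zf, hz⟩ with hZv
  set Yv : ↥(box 4 L) := ⟨y, hy⟩ with hYv
  set T : ↥(box 4 L) → ↥(box 4 L) → ℝ := boxTwoPt (box 4 L) β with hT
  have h1η : (0 : ℝ) < 1 - 1 / #𝒦 := by linarith
  have hZ : ∀ {a b : ↥(box 4 L)} {x : Site 4}, (1 - 1 / #𝒦) * S x ≤ T a b → ecurrentSum (Kc (box 4 L) β) ({a} ∆ {b}) ≠ 0 := by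
    intro a b x h h0
    have hpos : 0 < T a b := lt_of_lt_of_le (mul_pos h1η (hSpos x)) h
    rw [hT, boxTwoPt_eq_div hβ.le, h0, ENNReal.toReal_zero, zero_div] at hpos
    exact lt_irrefl _ hpos
  have hblkmem : ∀ {I : ℕ → Finset (Site 4)} {j : ℕ} {v : ↥(box 4 L)}, v ∈ blk U I j ↔ ((v : Site 4) - u) ∈ I j := by
    intro I j v; unfold blk; simp [hU]
  -- generic facts for one far point
  have hgen : ∀ {q : Site 4} (hq : q ∈ box 4 L) (hqN : N ≤ Site.supNorm (q - u)),
      (∀ k ∈ 𝒦, ∀ v ∈ arbFamily (q - u) k, u + v ∈ box 4 L) →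
      (∀ k ∈ 𝒦, ∀ v ∈ blk U (arbFamily (q - u)) k,
        (1 - 1 / #𝒦) * S ((v : Site 4) - u) ≤ T U v ∧ (1 - 1 / #𝒦) * S (q - (v : Site 4)) ≤ T v ⟨q, hq⟩) →
      (1 - 1 / #𝒦) * S (q - u) ≤ T U ⟨q, hq⟩ →
      (∀ j ∈ 𝒦, blkSum β U ⟨q, hq⟩ (arbFamily (q - u)) j ≠ 0) ∧ ecurrentSum (Kc (box 4 L) β) ({U} ∆ {⟨q, hq⟩}) ≠ 0 := by
    intro q hq hqN hIΛ hblk hlow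
    refine ⟨fun j hj => ?_, hZ hlow⟩
    have hne : (blk U (arbFamily (q - u)) j).Nonempty := by
      rw [← Finset.card_pos]
      have h1 : (0 : ℝ) < #(arbFamily (q - u) j) := lt_of_lt_of_le (by positivity) (hfam hqN j hj).2.1
      rw [← card_blk_eq U (arbFamily (q - u)) j (hIΛ j hj)] at h1
      exact_mod_cast h1
    obtain ⟨v, hv⟩ := hne
    unfold blkSum
    intro h0
    have := Finset.sum_eq_zero_iff.1 h0 v hv
    rcases mul_eq_zero.1 this with h | h
    · exact hZ (hblk j hj v hv).1 h
    · exact hZ (hblk j hj v hv).2 h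
  obtain ⟨hbx, hZx⟩ := hgen hx hxN hIΛx hblkx hlow_ux
  obtain ⟨hbz, hZz⟩ := hgen hz hzN hIΛz hblkz hlow_uz
  obtain ⟨hby, hZy⟩ := hgen hy hyN hIΛy hblky hlow_uy
  have hNxz : srcNrm (Kc (box 4 L) β) ({U} ∆ {Xv}) ({U} ∆ {Zv}) ≠ 0 := by
    unfold srcNrm
    exact mul_ne_zero (mul_ne_zero (ecurrentSum_empty_ne_zero _) hZx) (mul_ne_zero (ecurrentSum_empty_ne_zero _) hZz)
  have hNyy : srcNrm (Kc (box 4 L) β) ({U} ∆ {Yv}) ({U} ∆ {Yv}) ≠ 0 := by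
    unfold srcNrm
    exact mul_ne_zero (mul_ne_zero (ecurrentSum_empty_ne_zero _) hZy) (mul_ne_zero (ecurrentSum_empty_ne_zero _) hZy)
  -- the two families of switch weights
  set swA : ↥(box 4 L) → ↥(box 4 L) → ℝ := fun v₁ v₂ => switchWeight (Kc (box 4 L) β) U U Xv Zv
    (mixCoeff β U Xv 𝒦 (arbFamily (xf - u))) (mixCoeff β U Zv 𝒦 (arbFamily (zf - u))) v₁ v₂ with hswA
  set swB : ↥(box 4 L) → ↥(box 4 L) → ℝ := fun v₁ v₂ => switchWeight (Kc (box 4 L) β) U U Yv Yv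
    (mixCoeff β U Yv 𝒦 (arbFamily (y - u))) (mixCoeff β U Yv 𝒦 (arbFamily (y - u))) v₁ v₂ with hswB
  have hswA0 : ∀ v₁ v₂, 0 ≤ swA v₁ v₂ := fun v₁ v₂ => switchWeight_nonneg _ _ _ _ _ _ _ _ _
  have hswB0 : ∀ v₁ v₂, 0 ≤ swB v₁ v₂ := fun v₁ v₂ => switchWeight_nonneg _ _ _ _ _ _ _ _ _
  have hswA1 : ∑ v₁, ∑ v₂, swA v₁ v₂ = 1 := sum_switchWeight_eq_one hK U U Xv Zv
    (mixCoeff_ne_top U Xv 𝒦 _ hβ.le hbx) (mixCoeff_ne_top U Zv 𝒦 _ hβ.le hbz)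
    (sum_mixCoeff_mul U Xv 𝒦 _ hβ.le h𝒦ne hbx) (sum_mixCoeff_mul U Zv 𝒦 _ hβ.le h𝒦ne hbz) hNxz
  have hswB1 : ∑ v₁, ∑ v₂, swB v₁ v₂ = 1 := sum_switchWeight_eq_one hK U U Yv Yv
    (mixCoeff_ne_top U Yv 𝒦 _ hβ.le hby) (mixCoeff_ne_top U Yv 𝒦 _ hβ.le hby)
    (sum_mixCoeff_mul U Yv 𝒦 _ hβ.le h𝒦ne hby) (sum_mixCoeff_mul U Yv 𝒦 _ hβ.le h𝒦ne hby) hNyy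
  -- the inside functional
  set f : ↥(box 4 L) → ↥(box 4 L) → ℝ := fun v₁ v₂ => srcProb (Kc (box 4 L) β) ({U} ∆ {v₁}) ({U} ∆ {v₂}) Φ with hf
  have hΦmul : Φ * (fun _ => (1 : ℝ≥0∞)) = Φ := by funext x; simp
  have h1loc' : FourLocal (edgesBeyond (G := boxGraph (box 4 L)) ⟨u, hu⟩ (N - 1 + 1)) (fun _ : FourCfg (boxGraph (box 4 L)) => (1 : ℝ≥0∞)) :=
    fourLocal_const _ 1
  have hA := hAL hu hx hz Φ (fun _ => 1) hΦ1 (fun _ => le_rfl) hΦ h1loc'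
  have hB := hBL hu hy hy Φ (fun _ => 1) hΦ1 (fun _ => le_rfl) hΦ h1loc'
  rw [hΦmul] at hA hB
  -- `P^{v q}[1] = 1` on the supports
  have hsumA : ∑ v₁, ∑ v₂, swA v₁ v₂ * (f v₁ v₂ * srcProb (Kc (box 4 L) β) ({v₁} ∆ {Xv}) ({v₂} ∆ {Zv}) (fun _ => 1)) =
      ∑ v₁, ∑ v₂, swA v₁ v₂ * f v₁ v₂ := by
    refine Finset.sum_congr rfl fun v₁ _ => Finset.sum_congr rfl fun v₂ _ => ?_
    by_cases h0 : swA v₁ v₂ = 0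
    · rw [h0, zero_mul, zero_mul]
    · obtain ⟨⟨k₁, hk₁, hv₁⟩, ⟨k₂, hk₂, hv₂⟩⟩ := switchWeight_ne_zero_imp U Xv Zv 𝒦 _ _ h0
      have hN : srcNrm (Kc (box 4 L) β) ({v₁} ∆ {Xv}) ({v₂} ∆ {Zv}) ≠ 0 := by
        unfold srcNrm
        exact mul_ne_zero (mul_ne_zero (ecurrentSum_empty_ne_zero _) (hZ (hblkx k₁ hk₁ v₁ (hblkmem.2 hv₁)).2))
          (mul_ne_zero (ecurrentSum_empty_ne_zero _) (hZ (hblkz k₂ hk₂ v₂ (hblkmem.2 hv₂)).2))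
      rw [srcProb_one hK hN, mul_one]
  have hsumB : ∑ v₁, ∑ v₂, swB v₁ v₂ * (f v₁ v₂ * srcProb (Kc (box 4 L) β) ({v₁} ∆ {Yv}) ({v₂} ∆ {Yv}) (fun _ => 1)) =
      ∑ v₁, ∑ v₂, swB v₁ v₂ * f v₁ v₂ := by
    refine Finset.sum_congr rfl fun v₁ _ => Finset.sum_congr rfl fun v₂ _ => ?_
    by_cases h0 : swB v₁ v₂ = 0
    · rw [h0, zero_mul, zero_mul]
    · obtain ⟨⟨k₁, hk₁, hv₁⟩, ⟨k₂, hk₂, hv₂⟩⟩ := switchWeight_ne_zero_imp U Yv Yv 𝒦 _ _ h0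
      have hN : srcNrm (Kc (box 4 L) β) ({v₁} ∆ {Yv}) ({v₂} ∆ {Yv}) ≠ 0 := by
        unfold srcNrm
        exact mul_ne_zero (mul_ne_zero (ecurrentSum_empty_ne_zero _) (hZ (hblky k₁ hk₁ v₁ (hblkmem.2 hv₁)).2))
          (mul_ne_zero (ecurrentSum_empty_ne_zero _) (hZ (hblky k₂ hk₂ v₂ (hblkmem.2 hv₂)).2))
      rw [srcProb_one hK hN, mul_one]
  rw [hsumA] at hA
  rw [hsumB] at hB
  have hnest : ∀ sw F : ↥(box 4 L) → ↥(box 4 L) → ℝ, ∑ x : ↥(box 4 L) × ↥(box 4 L), sw x.1 x.2 * F x.1 x.2 =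
      ∑ v₁, ∑ v₂, sw v₁ v₂ * F v₁ v₂ := fun sw F => Fintype.sum_prod_type _
  rw [← hnest swA f] at hA
  rw [← hnest swB f] at hB
  have hδA1 : ∑ x : ↥(box 4 L) × ↥(box 4 L), swA x.1 x.2 = 1 := by rw [Fintype.sum_prod_type]; exact hswA1
  have hδB1 : ∑ x : ↥(box 4 L) × ↥(box 4 L), swB x.1 x.2 = 1 := by rw [Fintype.sum_prod_type]; exact hswB1
  -- membership of the supports in `Pall`
  have hmemPof : ∀ {q : Site 4} {v : ↥(box 4 L)} {k : ℕ}, k ∈ 𝒦 → ((v : Site 4) - u) ∈ arbFamily (q - u) k →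
      (v : Site 4) ∈ Pof q := by
    intro q v k hk hv
    rw [hPof, mem_biUnion]
    exact ⟨k, hk, mem_image.2 ⟨(v : Site 4) - u, hv, by abel⟩⟩
  have hsuppA : ∀ {x : ↥(box 4 L) × ↥(box 4 L)}, swA x.1 x.2 ≠ 0 → ((x.1 : ↥(box 4 L)) : Site 4) ∈ Pall ∧ ((x.2 : ↥(box 4 L)) : Site 4) ∈ Pall := by
    intro x hx
    obtain ⟨⟨k₁, hk₁, hv₁⟩, ⟨k₂, hk₂, hv₂⟩⟩ := switchWeight_ne_zero_imp U Xv Zv 𝒦 _ _ hx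
    rw [hPall]
    exact ⟨mem_union_left _ (mem_union_left _ (hmemPof hk₁ hv₁)), mem_union_left _ (mem_union_right _ (hmemPof hk₂ hv₂))⟩
  have hsuppB : ∀ {x : ↥(box 4 L) × ↥(box 4 L)}, swB x.1 x.2 ≠ 0 → ((x.1 : ↥(box 4 L)) : Site 4) ∈ Pall ∧ ((x.2 : ↥(box 4 L)) : Site 4) ∈ Pall := by
    intro x hx
    obtain ⟨⟨k₁, hk₁, hv₁⟩, ⟨k₂, hk₂, hv₂⟩⟩ := switchWeight_ne_zero_imp U Yv Yv 𝒦 _ _ hx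
    rw [hPall]
    exact ⟨mem_union_right _ (hmemPof hk₁ hv₁), mem_union_right _ (hmemPof hk₂ hv₂)⟩
  set ε₂ : ℝ := odErr c₀ C₀ CIR (1 / #𝒦') (Real.exp (-2) / (32 * criticalBeta 4) / (216 * (16 * ((2 ^ (20 * Q) : ℕ) : ℝ)) ^ 3))
      (4 * C₀ * (2 ^ (20 * Q) : ℕ) / 2 ^ (200 * Q)) #𝒦' n (2 ^ (4 * Q)) (2 ^ (7 * Q)) (2 ^ (7 * Q) - 1)
      (2 ^ (20 * Q)) (2 ^ (64 * Q)) (2 ^ (196 * Q)) with hε₂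
  have hod : ∀ x x' : ↥(box 4 L) × ↥(box 4 L),
      ((x.1 : ↥(box 4 L)) : Site 4) ∈ Pall ∧ ((x.2 : ↥(box 4 L)) : Site 4) ∈ Pall →
      ((x'.1 : ↥(box 4 L)) : Site 4) ∈ Pall ∧ ((x'.2 : ↥(box 4 L)) : Site 4) ∈ Pall →
      |f x.1 x.2 - f x'.1 x'.2| ≤ ε₂ := by
    intro x x' hx hx'
    have ht : ((((x.1 : ↥(box 4 L)) : Site 4), ((x.2 : ↥(box 4 L)) : Site 4)), (((x'.1 : ↥(box 4 L)) : Site 4), ((x'.2 : ↥(box 4 L)) : Site 4))) ∈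
        (Pall ×ˢ Pall) ×ˢ (Pall ×ˢ Pall) := by
      simp only [mem_product]; exact ⟨hx, hx'⟩
    exact hODL _ ht hu x.1.2 x.2.2 x'.1.2 x'.2.2 Φ hΦ1 hΦ
  -- a switch point in the support of `δ(·, x, (xf,zf))`
  obtain ⟨xs, -, hxs⟩ : ∃ xs ∈ (univ : Finset (↥(box 4 L) × ↥(box 4 L))), swA xs.1 xs.2 ≠ 0 := by
    by_contra hnone
    push Not at hnone
    have : ∑ x : ↥(box 4 L) × ↥(box 4 L), swA x.1 x.2 = 0 := Finset.sum_eq_zero fun x hx => hnone x hx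
    rw [hδA1] at this
    exact one_ne_zero this
  have hpivA := abs_sub_le_of_switch_pivot (univ : Finset (↥(box 4 L) × ↥(box 4 L))) (δ := fun z => swA z.1 z.2)
    (f := fun z => f z.1 z.2) (Q := f xs.1 xs.2) (fun z _ => hswA0 _ _) hδA1 hA
    (fun z _ hz => hod z xs (hsuppA hz) (hsuppA hxs))
  have hpivB := abs_sub_le_of_switch_pivot (univ : Finset (↥(box 4 L) × ↥(box 4 L))) (δ := fun z => swB z.1 z.2)
    (f := fun z => f z.1 z.2) (Q := f xs.1 xs.2) (fun z _ => hswB0 _ _) hδB1 hB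
    (fun z _ hz => hod z xs (hsuppB hz) (hsuppA hxs))
  calc |srcProb (Kc (box 4 L) β) ({U} ∆ {Xv}) ({U} ∆ {Zv}) Φ - srcProb (Kc (box 4 L) β) ({U} ∆ {Yv}) ({U} ∆ {Yv}) Φ|
      = |(srcProb (Kc (box 4 L) β) ({U} ∆ {Xv}) ({U} ∆ {Zv}) Φ - f xs.1 xs.2) -
          (srcProb (Kc (box 4 L) β) ({U} ∆ {Yv}) ({U} ∆ {Yv}) Φ - f xs.1 xs.2)| := by ring_nf
    _ ≤ |srcProb (Kc (box 4 L) β) ({U} ∆ {Xv}) ({U} ∆ {Zv}) Φ - f xs.1 xs.2| +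
        |srcProb (Kc (box 4 L) β) ({U} ∆ {Yv}) ({U} ∆ {Yv}) Φ - f xs.1 xs.2| := abs_sub _ _
    _ ≤ _ := by linarith [hpivA, hpivB]

/-! ### The rate `(log N/n)^{-1/2}` -/

/-- `1/2^Q ≤ 1/√Q` (`Q ≥ 1`). [folklore] -/
theorem inv_two_pow_le_inv_sqrt {Q : ℕ} (hQ : 1 ≤ Q) : 1 / (2 : ℝ) ^ Q ≤ 1 / Real.sqrt Q := by
  have hQ0 : (0 : ℝ) < Q := by exact_mod_cast hQ
  refine one_div_le_one_div_of_le (Real.sqrt_pos.2 hQ0) ?_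
  calc Real.sqrt Q ≤ Q := by
        rw [Real.sqrt_le_left (by positivity)]
        have : (1 : ℝ) ≤ Q := by exact_mod_cast hQ
        nlinarith
    _ ≤ 2 ^ Q := by exact_mod_cast (Nat.lt_two_pow_self (n := Q)).le

/-- `1/Q ≤ 1/√Q` (`Q ≥ 1`). [folklore] -/
theorem inv_le_inv_sqrt {Q : ℕ} (hQ : 1 ≤ Q) : 1 / (Q : ℝ) ≤ 1 / Real.sqrt Q := by
  have hQ0 : (0 : ℝ) < Q := by exact_mod_cast hQ
  refine one_div_le_one_div_of_le (Real.sqrt_pos.2 hQ0) ?_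
  rw [Real.sqrt_le_left (by positivity)]
  have : (1 : ℝ) ≤ Q := by exact_mod_cast hQ
  nlinarith

/-- `1/√(κQ) = (1/√κ)(1/√Q)` bound: for `κ > 0`, `m ≥ κ Q`, `1/√m ≤ (1/√κ)·(1/√Q)`. [folklore] -/
theorem inv_sqrt_le_of_ge {κ : ℝ} (hκ : 0 < κ) {Q m : ℕ} (hQ : 1 ≤ Q) (hm : κ * Q ≤ m) :
    1 / Real.sqrt m ≤ 1 / Real.sqrt κ * (1 / Real.sqrt Q) := by
  have hQ0 : (0 : ℝ) < Q := by exact_mod_cast hQ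
  rw [div_mul_div_comm, one_mul, ← Real.sqrt_mul hκ.le]
  exact one_div_le_one_div_of_le (Real.sqrt_pos.2 (by positivity)) (Real.sqrt_le_sqrt hm)

/-- From `1/√Q` to `(log N/n)^{-1/2}`: if `0 < log(N/n) ≤ D·Q` then `1/√Q ≤ √D · (log(N/n))^{-1/2}`. [folklore] -/
theorem inv_sqrt_le_rpow_log {D x : ℝ} {Q : ℕ} (hD : 0 < D) (hx : 0 < x) (hQ : 1 ≤ Q) (h : x ≤ D * Q) :
    1 / Real.sqrt Q ≤ Real.sqrt D * x ^ (-(1 / 2 : ℝ)) := by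
  have hQ0 : (0 : ℝ) < Q := by exact_mod_cast hQ
  rw [Real.rpow_neg hx.le, ← Real.sqrt_eq_rpow, ← div_eq_mul_inv, div_le_div_iff₀ (Real.sqrt_pos.2 hQ0) (Real.sqrt_pos.2 hx),
    one_mul, ← Real.sqrt_mul hD.le]
  exact Real.sqrt_le_sqrt h

set_option maxHeartbeats 2000000 in
open Classical in
/-- **Theorem 6.4, (6.8), for `t = 2`, `s = 4`, centre sources and far sources `(y,y)`, along the boxes `Λ_L ↑ ℤ⁴`**
(the hypothesis `Hmix` of `improvedTreeDiagramBound_of_intersection_and_mixing`): there are `α, c, C > 0` and `n₀`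
such that for `0 < β ≤ β_c`, `n ≥ n₀`, `n^α ≤ N` in the window and `‖y-u‖ ≥ N`, for all large `L` and all
`[0,1]`-valued `Φ` local inside `Λ_n(u)` and `Ψ` local outside `Λ_N(u)`,
`E^{uy,uy}_{Λ_L}[ΦΨ]·N ≤ E[Φ]·E[Ψ] + C(log N/n)^{-c} N²` (here `α = 20000`, `c = 1/2`).
[cite: AizenmanDuminilCopinAnnals2021, arXiv:1912.07973 Theorem 6.4, (6.8) (p. 21–22); proof §6.2 (pp. 23–26)] -/
theorem mixing_Hmix : ∃ α c C : ℝ, ∃ n₀ : ℕ, 0 < c ∧ 0 < C ∧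
      ∀ β : ℝ, 0 < β → β ≤ criticalBeta 4 → ∀ u y : Site 4, ∀ n N : ℕ, n₀ ≤ n → (n : ℝ) ^ α ≤ N →
        (β = criticalBeta 4 ∨ (0 < β ∧ (N : ℝ) * invCorrLength (twoPointPlus 4 β) ≤ 1)) →
        (N : ℝ) ≤ dist u y →
        ∀ᶠ L : ℕ in atTop, ∀ Φ Ψ : Current.FourCfg (boxGraph (box 4 L)) → ℝ≥0∞,
          (∀ pq, Φ pq ≤ 1) → (∀ pq, Ψ pq ≤ 1) →
          Current.FourLocal (latEdgesWithin (box 4 L) u n) Φ →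
          Current.FourLocal (latEdgesBeyond (box 4 L) u N) Ψ →
          finVolFourMass (box 4 L) β u y y (Φ * Ψ) * finVolFourNrm (box 4 L) β u y y ≤
            finVolFourMass (box 4 L) β u y y Φ * finVolFourMass (box 4 L) β u y y Ψ +
              ENNReal.ofReal (C * Real.log ((N : ℝ) / n) ^ (-c)) * finVolFourNrm (box 4 L) β u y y ^ 2 := by
  obtain ⟨c₀, C₀, L₀, cK, CK, hc₀, hC₀, hL₀, hsepL, hcK, Hsc⟩ := exists_regular_separated_scales
  obtain ⟨CIR, hCIR, HIR⟩ := twoPointFree_infraredBound_four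
  -- constants
  set A : ℝ := 15 + 16 * twoSiteConst c₀ C₀ 0 (1 / 4096) with hA
  set A' : ℝ := 15 + 16 * twoSiteConst c₀ C₀ (8 * C₀) (1 / 16) with hA'
  set KT : ℝ := (2 * (746496 * CIR ^ 2 + 746496 * CIR ^ 2) +
    2 * (1728 * CIR ^ 2 * (32 * criticalBeta 4 * Real.exp 2 * 216 * 16 ^ 3) + 746496 * CIR ^ 2 + 1728 * CIR + 746496 * CIR ^ 2)) with hKT
  set KL : ℝ := (2 * (746496 * CIR ^ 2 + 746496 * CIR ^ 2) +
    2 * (1728 * CIR ^ 2 * (32 * criticalBeta 4 * Real.exp 2 * 216 * 16 ^ 3) + 746496 * CIR ^ 2 + 1728 * (1 + 4 * C₀) * CIR +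
      746496 * CIR ^ 2)) with hKL
  set κ : ℝ := 799 * cK / 2 with hκ
  set κ' : ℝ := 6 * cK with hκ'
  have hκ0 : 0 < κ := by rw [hκ]; positivity
  have hκ'0 : 0 < κ' := by rw [hκ']; positivity
  set KE : ℝ := 3 * (Real.sqrt (2 * A + A ^ 2) / Real.sqrt κ + KT) +
    2 * (Real.sqrt (2 * A' + A' ^ 2) / Real.sqrt κ' + KL + 128 * C₀ + 11 / κ') with hKE
  set Cfin : ℝ := |KE| * Real.sqrt (20000 * Real.log 2) + 1 with hCfin
  set Q₀ : ℕ := max (max ⌈2 * (CK + 10) / (799 * cK)⌉₊ ⌈(CK + 10) / (6 * cK)⌉₊) ⌈4 * C₀⌉₊ with hQ₀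
  refine ⟨20000, 1 / 2, Cfin, 2 ^ (Q₀ + 2), by norm_num, by rw [hCfin]; positivity, ?_⟩
  intro β hβ hβc u y n N hn₀ hnN hwin hdist
  have hβc0 : 0 < criticalBeta 4 := lt_of_lt_of_le hβ hβc
  -- the grid
  have hn2 : 2 ≤ n := le_trans (by
    calc 2 ≤ 2 ^ 2 := by norm_num
      _ ≤ 2 ^ (Q₀ + 2) := Nat.pow_le_pow_right (by norm_num) (by omega)) hn₀
  have hnNnat : n ^ 20000 ≤ N := by
    have : ((n : ℝ) ^ (20000 : ℕ)) ≤ N := by rw [← Real.rpow_natCast]; exact_mod_cast hnN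
    exact_mod_cast this
  obtain ⟨hQ1, hnQ, hNQ, hlogQ, hQ₀Q⟩ := grid_spec (Q₀ := Q₀) hn2 hnNnat
  clear hnNnat
  have h2nN : 2 * n ≤ N := by
    calc 2 * n ≤ 2 * 2 ^ (Nat.log 2 N / 10000) := Nat.mul_le_mul_left 2 hnQ.le
      _ = 2 ^ (Nat.log 2 N / 10000 + 1) := by ring
      _ ≤ 2 ^ (10000 * (Nat.log 2 N / 10000)) := Nat.pow_le_pow_right (by norm_num) (by omega)
      _ ≤ N := hNQ
  have hlogpos : 0 < Real.log ((N : ℝ) / n) := by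
    have hn0 : (0 : ℝ) < n := by exact_mod_cast lt_of_lt_of_le (by norm_num) hn2
    apply Real.log_pos
    rw [lt_div_iff₀ hn0, one_mul]
    have : ((2 * n : ℕ) : ℝ) ≤ N := by exact_mod_cast h2nN
    push_cast at this; linarith
  set Q : ℕ := Nat.log 2 N / 10000 with hQdef
  have hQ₀le : Q₀ ≤ Q := hQ₀Q hn₀
  have hQ0 : (0 : ℝ) < Q := by exact_mod_cast hQ1
  -- distances
  have hyN : N ≤ Site.supNorm (y - u) := by
    rw [Site.dist_eq_supNorm, Site.supNorm_sub_comm] at hdist; exact_mod_cast hdist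
  -- the two sets of scales
  have hwin999 : β = criticalBeta 4 ∨ (0 < β ∧ ((2 ^ (999 * Q) : ℕ) : ℝ) * invCorrLength (twoPointPlus 4 β) ≤ 1) :=
    adcWindow_mono hβ.le hwin (by exact_mod_cast (pow_grid_le (a := 999) (b := 10000) (by norm_num)).trans hNQ)
  have hwin19 : β = criticalBeta 4 ∨ (0 < β ∧ ((2 ^ (19 * Q) : ℕ) : ℝ) * invCorrLength (twoPointPlus 4 β) ≤ 1) :=
    adcWindow_mono hβ.le hwin (by exact_mod_cast (pow_grid_le (a := 19) (b := 10000) (by norm_num)).trans hNQ)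
  obtain ⟨𝒦, h𝒦, hreg, hsep, hcard⟩ := Hsc β hβ hβc (200 * Q) (999 * Q) (by omega) (by omega) hwin999
  obtain ⟨𝒦', h𝒦', hreg', hsep', hcard'⟩ := Hsc β hβ hβc (7 * Q) (19 * Q) (by omega) (by omega) hwin19
  -- sizes of `𝒦`, `𝒦'`
  have hQ₀a : 2 * (CK + 10) / (799 * cK) ≤ Q := by
    have h1 : (⌈2 * (CK + 10) / (799 * cK)⌉₊ : ℝ) ≤ Q := by exact_mod_cast le_trans (le_trans (le_max_left _ _) (le_max_left _ _)) hQ₀le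
    exact (Nat.le_ceil _).trans h1
  have hQ₀b : (CK + 10) / (6 * cK) ≤ Q := by
    have h1 : (⌈(CK + 10) / (6 * cK)⌉₊ : ℝ) ≤ Q := by exact_mod_cast le_trans (le_trans (le_max_right _ _) (le_max_left _ _)) hQ₀le
    exact (Nat.le_ceil _).trans h1
  have hQ₀c : 4 * C₀ ≤ Q := by
    have h1 : (⌈4 * C₀⌉₊ : ℝ) ≤ Q := by exact_mod_cast le_trans (le_max_right _ _) hQ₀le
    exact (Nat.le_ceil _).trans h1
  have hK10 : κ * Q + 10 ≤ #𝒦 := by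
    have h799 : ((999 * Q : ℕ) : ℝ) - (200 * Q : ℕ) = 799 * Q := by push_cast; ring
    rw [h799] at hcard
    have : 799 * cK * Q / 2 ≥ CK + 10 := by
      rw [div_le_iff₀ (by positivity)] at hQ₀a; linarith
    rw [hκ]; nlinarith
  have hK'10 : κ' * Q + 10 ≤ #𝒦' := by
    have h12 : ((19 * Q : ℕ) : ℝ) - (7 * Q : ℕ) = 12 * Q := by push_cast; ring
    rw [h12] at hcard'
    have : 6 * cK * Q ≥ CK + 10 := by
      rw [div_le_iff₀ (by positivity)] at hQ₀b; linarith
    rw [hκ']; nlinarith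
  have hcard10 : 10 ≤ #𝒦 := by
    have : (10 : ℝ) ≤ #𝒦 := by nlinarith [hK10, mul_nonneg hκ0.le hQ0.le]
    exact_mod_cast this
  have hcard10' : 10 ≤ #𝒦' := by
    have : (10 : ℝ) ≤ #𝒦' := by nlinarith [hK'10, mul_nonneg hκ'0.le hQ0.le]
    exact_mod_cast this
  -- the main estimate at scale `Q`
  have hmain := mixing_at_scale hβ hβc hCIR (HIR β hβ.le hβc) u y hc₀ hC₀ 𝒦 𝒦' hQ1 (by omega) hnQ hNQ hwin hyN
    h𝒦 hreg hsep hcard10 h𝒦' hreg' hsep' hcard10'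
  -- the error bound
  have hKE : 3 * (concErr c₀ C₀ 0 (1 / 4096) (1 / #𝒦) #𝒦 +
        splitErr CIR (1 / #𝒦) (Real.exp (-2) / (32 * criticalBeta 4) / (216 * (16 * ((2 ^ (1000 * Q) : ℕ) : ℝ)) ^ 3)) 1 n
          (2 ^ (100 * Q)) (2 ^ (200 * Q)) (2 ^ (200 * Q) - 1) (2 ^ (1000 * Q)) (2 ^ (3100 * Q)) (N - 1)) +
      odErr c₀ C₀ CIR (1 / #𝒦') (Real.exp (-2) / (32 * criticalBeta 4) / (216 * (16 * ((2 ^ (20 * Q) : ℕ) : ℝ)) ^ 3))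
        (4 * C₀ * (2 ^ (20 * Q) : ℕ) / 2 ^ (200 * Q)) #𝒦' n (2 ^ (4 * Q)) (2 ^ (7 * Q)) (2 ^ (7 * Q) - 1)
        (2 ^ (20 * Q)) (2 ^ (64 * Q)) (2 ^ (196 * Q)) ≤ KE * (1 / Real.sqrt Q) := by
    have hisq : 0 ≤ 1 / Real.sqrt Q := by positivity
    -- top level
    have hη2 : (1 : ℝ) / #𝒦 ≤ 1 / 2 := one_div_le_one_div_of_le (by norm_num) (by exact_mod_cast (show 2 ≤ #𝒦 by omega))
    have hc1 : concErr c₀ C₀ 0 (1 / 4096) (1 / #𝒦) #𝒦 ≤ Real.sqrt (2 * A + A ^ 2) / Real.sqrt κ * (1 / Real.sqrt Q) := by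
      refine (concErr_le hc₀ hC₀.le le_rfl (by norm_num) hcard10).trans ?_
      rw [← hA, div_eq_mul_one_div]
      calc Real.sqrt (2 * A + A ^ 2) * (1 / Real.sqrt #𝒦) ≤ Real.sqrt (2 * A + A ^ 2) * (1 / Real.sqrt κ * (1 / Real.sqrt Q)) :=
            mul_le_mul_of_nonneg_left (inv_sqrt_le_of_ge hκ0 hQ1 (by linarith)) (Real.sqrt_nonneg _)
        _ = _ := by ring
    have hs1 : splitErr CIR (1 / #𝒦) (Real.exp (-2) / (32 * criticalBeta 4) / (216 * (16 * ((2 ^ (1000 * Q) : ℕ) : ℝ)) ^ 3)) 1 n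
        (2 ^ (100 * Q)) (2 ^ (200 * Q)) (2 ^ (200 * Q) - 1) (2 ^ (1000 * Q)) (2 ^ (3100 * Q)) (N - 1) ≤ KT * (1 / Real.sqrt Q) := by
      refine (splitErr_top_le hCIR hβc0 hη2 hQ1 (by omega) hnQ hNQ).trans ?_
      rw [← hKT, div_eq_mul_one_div]
      exact mul_le_mul_of_nonneg_left (inv_two_pow_le_inv_sqrt hQ1) (by rw [hKT]; positivity)
    -- lower level
    have hη2' : (1 : ℝ) / #𝒦' ≤ 1 / 2 := one_div_le_one_div_of_le (by norm_num) (by exact_mod_cast (show 2 ≤ #𝒦' by omega))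
    have hc2 : concErr c₀ C₀ (8 * C₀) (1 / 16) (1 / #𝒦') #𝒦' ≤ Real.sqrt (2 * A' + A' ^ 2) / Real.sqrt κ' * (1 / Real.sqrt Q) := by
      refine (concErr_le hc₀ hC₀.le (by positivity) (by norm_num) hcard10').trans ?_
      rw [← hA', div_eq_mul_one_div]
      calc Real.sqrt (2 * A' + A' ^ 2) * (1 / Real.sqrt #𝒦') ≤ Real.sqrt (2 * A' + A' ^ 2) * (1 / Real.sqrt κ' * (1 / Real.sqrt Q)) :=
            mul_le_mul_of_nonneg_left (inv_sqrt_le_of_ge hκ'0 hQ1 (by linarith)) (Real.sqrt_nonneg _)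
        _ = _ := by ring
    have hs2 : splitErr CIR (1 / #𝒦') (Real.exp (-2) / (32 * criticalBeta 4) / (216 * (16 * ((2 ^ (20 * Q) : ℕ) : ℝ)) ^ 3)) (1 + 4 * C₀) n
        (2 ^ (4 * Q)) (2 ^ (7 * Q)) (2 ^ (7 * Q) - 1) (2 ^ (20 * Q)) (2 ^ (64 * Q)) (2 ^ (196 * Q)) ≤ KL * (1 / Real.sqrt Q) := by
      refine (splitErr_low_le hCIR hβc0 hη2' hC₀.le hQ1 (by omega) hnQ).trans ?_
      rw [← hKL, div_eq_mul_one_div]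
      exact mul_le_mul_of_nonneg_left (inv_two_pow_le_inv_sqrt hQ1) (by rw [hKL]; positivity)
    have hζ : 4 * C₀ * ((2 ^ (20 * Q) : ℕ) : ℝ) / 2 ^ (200 * Q) ≤ 4 * C₀ * (1 / 2 ^ Q) := by
      rw [mul_one_div, div_le_div_iff₀ (by positivity) (by positivity)]
      have : ((2 ^ (20 * Q) : ℕ) : ℝ) * 2 ^ Q ≤ 2 ^ (200 * Q) := by
        have := two_pow_mul_le (a := 20) (b := 200) (Q := Q) (by norm_num)
        push_cast; exact this
      nlinarith [hC₀.le]
    have hζ1 : 4 * C₀ * ((2 ^ (20 * Q) : ℕ) : ℝ) / 2 ^ (200 * Q) ≤ 1 := by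
      refine hζ.trans ?_
      rw [mul_one_div, div_le_one (by positivity)]
      calc 4 * C₀ ≤ Q := hQ₀c
        _ ≤ 2 ^ Q := by exact_mod_cast (Nat.lt_two_pow_self (n := Q)).le
    have hζ0 : 0 ≤ 4 * C₀ * ((2 ^ (20 * Q) : ℕ) : ℝ) / 2 ^ (200 * Q) := by positivity
    have hη10' : (1 : ℝ) / #𝒦' ≤ 1 / 10 := one_div_le_one_div_of_le (by norm_num) (by exact_mod_cast hcard10')
    have hcl : (1 + 4 * C₀ * ((2 ^ (20 * Q) : ℕ) : ℝ) / 2 ^ (200 * Q)) ^ 4 / (1 - 1 / #𝒦') ^ 4 - 1 ≤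
        (128 * C₀ + 11 / κ') * (1 / Real.sqrt Q) := by
      refine (closeness_le hζ0 hζ1 (by positivity) hη10').trans ?_
      have h1 : (1 : ℝ) / #𝒦' ≤ 1 / κ' * (1 / Real.sqrt Q) := by
        calc (1 : ℝ) / #𝒦' ≤ 1 / (κ' * Q) := one_div_le_one_div_of_le (by positivity) (by linarith)
          _ = 1 / κ' * (1 / Q) := by rw [one_div_mul_one_div]
          _ ≤ 1 / κ' * (1 / Real.sqrt Q) := mul_le_mul_of_nonneg_left (inv_le_inv_sqrt hQ1) (by positivity)
      have h2 : (1 : ℝ) / 2 ^ Q ≤ 1 / Real.sqrt Q := inv_two_pow_le_inv_sqrt hQ1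
      calc 32 * (4 * C₀ * ((2 ^ (20 * Q) : ℕ) : ℝ) / 2 ^ (200 * Q)) + 11 * (1 / #𝒦')
          ≤ 32 * (4 * C₀ * (1 / Real.sqrt Q)) + 11 * (1 / κ' * (1 / Real.sqrt Q)) := by
            have := mul_le_mul_of_nonneg_left h2 (show (0:ℝ) ≤ 4 * C₀ by positivity)
            nlinarith [hζ, h1]
        _ = (128 * C₀ + 11 / κ') * (1 / Real.sqrt Q) := by ring
    unfold odErr
    rw [hKE]
    nlinarith [hc1, hs1, hc2, hs2, hcl, hisq]
  -- the rate
  have hrate : KE * (1 / Real.sqrt Q) ≤ Cfin * Real.log ((N : ℝ) / n) ^ (-(1 / 2 : ℝ)) := by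
    have h1 := inv_sqrt_le_rpow_log (D := 20000 * Real.log 2) (by have := Real.log_pos (show (1:ℝ) < 2 by norm_num); positivity)
      hlogpos hQ1 (by linarith [hlogQ])
    have hr0 : 0 ≤ Real.log ((N : ℝ) / n) ^ (-(1 / 2 : ℝ)) := Real.rpow_nonneg hlogpos.le _
    calc KE * (1 / Real.sqrt Q) ≤ |KE| * (1 / Real.sqrt Q) := mul_le_mul_of_nonneg_right (le_abs_self _) (by positivity)
      _ ≤ |KE| * (Real.sqrt (20000 * Real.log 2) * Real.log ((N : ℝ) / n) ^ (-(1 / 2 : ℝ))) :=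
          mul_le_mul_of_nonneg_left h1 (abs_nonneg _)
      _ ≤ Cfin * Real.log ((N : ℝ) / n) ^ (-(1 / 2 : ℝ)) := by rw [hCfin]; nlinarith [hr0, abs_nonneg KE]
  -- conclusion along the boxes
  filter_upwards [hmain] with L hL
  intro Φ Ψ hΦ1 hΨ1 hΦ hΨ
  by_cases hmem : u ∈ box 4 L ∧ y ∈ box 4 L
  · obtain ⟨hu, hy⟩ := hmem
    have hK : ∀ e, 0 ≤ Kc (box 4 L) β e := fun _ => hβ.le
    rw [latEdgesWithin_eq hu] at hΦ
    rw [latEdgesBeyond_eq hu] at hΨ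
    have h := hL hu hy Φ Ψ hΦ1 hΨ1 hΦ hΨ
    have hle : Current.srcProb (Kc (box 4 L) β) ({⟨u, hu⟩} ∆ {⟨y, hy⟩}) ({⟨u, hu⟩} ∆ {⟨y, hy⟩}) (Φ * Ψ) ≤
        Current.srcProb (Kc (box 4 L) β) ({⟨u, hu⟩} ∆ {⟨y, hy⟩}) ({⟨u, hu⟩} ∆ {⟨y, hy⟩}) Φ *
          Current.srcProb (Kc (box 4 L) β) ({⟨u, hu⟩} ∆ {⟨y, hy⟩}) ({⟨u, hu⟩} ∆ {⟨y, hy⟩}) Ψ +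
        Cfin * Real.log ((N : ℝ) / n) ^ (-(1 / 2 : ℝ)) := by
      have := (abs_sub_le_iff.1 h).1
      linarith [hKE, hrate]
    by_cases hN0 : Current.srcNrm (Kc (box 4 L) β) ({⟨u, hu⟩} ∆ {⟨y, hy⟩}) ({⟨u, hu⟩} ∆ {⟨y, hy⟩}) = 0
    · -- degenerate normalisation: everything vanishes
      rw [finVolFourMass_eq_srcMass β hu hy hy, finVolFourNrm_eq_srcNrm β hu hy hy, hN0, mul_zero]
      exact zero_le
    · have hconv := Current.srcMass_mul_le_of_srcProb_le hK hN0 hΦ1 hΨ1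
        (by have := Real.rpow_nonneg hlogpos.le (-(1 / 2 : ℝ)); positivity) hle
      rw [finVolFourMass_eq_srcMass β hu hy hy, finVolFourMass_eq_srcMass β hu hy hy, finVolFourMass_eq_srcMass β hu hy hy,
        finVolFourNrm_eq_srcNrm β hu hy hy]
      exact hconv
  · -- points off the box: the finite-volume quantities are the junk value `0`
    have h0 : finVolFourMass (box 4 L) β u y y (Φ * Ψ) = 0 := by
      unfold finVolFourMass
      rw [dif_neg (fun h => hmem ⟨h.1, h.2.1⟩)]
    rw [h0, zero_mul]
    exact zero_le

set_option maxHeartbeats 2000000 in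
open Classical in
/-- **Theorem 6.4, (6.9), for `t = 2`, centre sources, far sources `(x,z)` versus `(y,y)`, along the boxes
`Λ_L ↑ ℤ⁴`** (the hypothesis `Hrel` of `improvedTreeDiagramBound_of_intersection_and_mixing`): there are `α, c, C > 0`
and `n₀` such that for `0 < β ≤ β_c`, `n ≥ n₀`, `n^α ≤ N` in the window and `‖x-u‖, ‖z-u‖, ‖y-u‖ ≥ N`, for all large
`L` and all `[0,1]`-valued `Φ` local inside `Λ_n(u)`,
`E^{ux,uz}_{Λ_L}[Φ]·N_{yy} ≤ E^{uy,uy}_{Λ_L}[Φ]·N_{xz} + C(log N/n)^{-c} N_{xz}N_{yy}` (here `α = 20000`, `c = 1/2`).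
[cite: AizenmanDuminilCopinAnnals2021, arXiv:1912.07973 Theorem 6.4, (6.9) (p. 22); proof §6.2 (pp. 25–26)] -/
theorem mixing_Hrel : ∃ α c C : ℝ, ∃ n₀ : ℕ, 0 < c ∧ 0 < C ∧
      ∀ β : ℝ, 0 < β → β ≤ criticalBeta 4 → ∀ u x z y : Site 4, ∀ n N : ℕ, n₀ ≤ n → (n : ℝ) ^ α ≤ N →
        (β = criticalBeta 4 ∨ (0 < β ∧ (N : ℝ) * invCorrLength (twoPointPlus 4 β) ≤ 1)) →
        (N : ℝ) ≤ dist u x → (N : ℝ) ≤ dist u z → (N : ℝ) ≤ dist u y →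
        ∀ᶠ L : ℕ in atTop, ∀ Φ : Current.FourCfg (boxGraph (box 4 L)) → ℝ≥0∞, (∀ pq, Φ pq ≤ 1) →
          Current.FourLocal (latEdgesWithin (box 4 L) u n) Φ →
          finVolFourMass (box 4 L) β u x z Φ * finVolFourNrm (box 4 L) β u y y ≤
            finVolFourMass (box 4 L) β u y y Φ * finVolFourNrm (box 4 L) β u x z +
              ENNReal.ofReal (C * Real.log ((N : ℝ) / n) ^ (-c)) *
                (finVolFourNrm (box 4 L) β u x z * finVolFourNrm (box 4 L) β u y y) := by
  obtain ⟨c₀, C₀, L₀, cK, CK, hc₀, hC₀, hL₀, hsepL, hcK, Hsc⟩ := exists_regular_separated_scales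
  obtain ⟨CIR, hCIR, HIR⟩ := twoPointFree_infraredBound_four
  -- constants
  set A : ℝ := 15 + 16 * twoSiteConst c₀ C₀ 0 (1 / 4096) with hA
  set A' : ℝ := 15 + 16 * twoSiteConst c₀ C₀ (8 * C₀) (1 / 16) with hA'
  set KT : ℝ := (2 * (746496 * CIR ^ 2 + 746496 * CIR ^ 2) +
    2 * (1728 * CIR ^ 2 * (32 * criticalBeta 4 * Real.exp 2 * 216 * 16 ^ 3) + 746496 * CIR ^ 2 + 1728 * CIR + 746496 * CIR ^ 2)) with hKT
  set KL : ℝ := (2 * (746496 * CIR ^ 2 + 746496 * CIR ^ 2) +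
    2 * (1728 * CIR ^ 2 * (32 * criticalBeta 4 * Real.exp 2 * 216 * 16 ^ 3) + 746496 * CIR ^ 2 + 1728 * (1 + 4 * C₀) * CIR +
      746496 * CIR ^ 2)) with hKL
  set κ : ℝ := 799 * cK / 2 with hκ
  set κ' : ℝ := 6 * cK with hκ'
  have hκ0 : 0 < κ := by rw [hκ]; positivity
  have hκ'0 : 0 < κ' := by rw [hκ']; positivity
  set KE : ℝ := 2 * (Real.sqrt (2 * A + A ^ 2) / Real.sqrt κ + KT) +
    4 * (Real.sqrt (2 * A' + A' ^ 2) / Real.sqrt κ' + KL + 128 * C₀ + 11 / κ') with hKE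
  set Cfin : ℝ := |KE| * Real.sqrt (20000 * Real.log 2) + 1 with hCfin
  set Q₀ : ℕ := max (max ⌈2 * (CK + 10) / (799 * cK)⌉₊ ⌈(CK + 10) / (6 * cK)⌉₊) ⌈4 * C₀⌉₊ with hQ₀
  refine ⟨20000, 1 / 2, Cfin, 2 ^ (Q₀ + 2), by norm_num, by rw [hCfin]; positivity, ?_⟩
  intro β hβ hβc u xf zf y n N hn₀ hnN hwin hdistx hdistz hdist
  have hβc0 : 0 < criticalBeta 4 := lt_of_lt_of_le hβ hβc
  -- the grid
  have hn2 : 2 ≤ n := le_trans (by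
    calc 2 ≤ 2 ^ 2 := by norm_num
      _ ≤ 2 ^ (Q₀ + 2) := Nat.pow_le_pow_right (by norm_num) (by omega)) hn₀
  have hnNnat : n ^ 20000 ≤ N := by
    have : ((n : ℝ) ^ (20000 : ℕ)) ≤ N := by rw [← Real.rpow_natCast]; exact_mod_cast hnN
    exact_mod_cast this
  obtain ⟨hQ1, hnQ, hNQ, hlogQ, hQ₀Q⟩ := grid_spec (Q₀ := Q₀) hn2 hnNnat
  clear hnNnat
  have h2nN : 2 * n ≤ N := by
    calc 2 * n ≤ 2 * 2 ^ (Nat.log 2 N / 10000) := Nat.mul_le_mul_left 2 hnQ.le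
      _ = 2 ^ (Nat.log 2 N / 10000 + 1) := by ring
      _ ≤ 2 ^ (10000 * (Nat.log 2 N / 10000)) := Nat.pow_le_pow_right (by norm_num) (by omega)
      _ ≤ N := hNQ
  have hlogpos : 0 < Real.log ((N : ℝ) / n) := by
    have hn0 : (0 : ℝ) < n := by exact_mod_cast lt_of_lt_of_le (by norm_num) hn2
    apply Real.log_pos
    rw [lt_div_iff₀ hn0, one_mul]
    have : ((2 * n : ℕ) : ℝ) ≤ N := by exact_mod_cast h2nN
    push_cast at this; linarith
  set Q : ℕ := Nat.log 2 N / 10000 with hQdef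
  have hQ₀le : Q₀ ≤ Q := hQ₀Q hn₀
  have hQ0 : (0 : ℝ) < Q := by exact_mod_cast hQ1
  -- distances
  have hyN : N ≤ Site.supNorm (y - u) := by
    rw [Site.dist_eq_supNorm, Site.supNorm_sub_comm] at hdist; exact_mod_cast hdist
  have hxN : N ≤ Site.supNorm (xf - u) := by
    rw [Site.dist_eq_supNorm, Site.supNorm_sub_comm] at hdistx; exact_mod_cast hdistx
  have hzN : N ≤ Site.supNorm (zf - u) := by
    rw [Site.dist_eq_supNorm, Site.supNorm_sub_comm] at hdistz; exact_mod_cast hdistz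
  -- the two sets of scales
  have hwin999 : β = criticalBeta 4 ∨ (0 < β ∧ ((2 ^ (999 * Q) : ℕ) : ℝ) * invCorrLength (twoPointPlus 4 β) ≤ 1) :=
    adcWindow_mono hβ.le hwin (by exact_mod_cast (pow_grid_le (a := 999) (b := 10000) (by norm_num)).trans hNQ)
  have hwin19 : β = criticalBeta 4 ∨ (0 < β ∧ ((2 ^ (19 * Q) : ℕ) : ℝ) * invCorrLength (twoPointPlus 4 β) ≤ 1) :=
    adcWindow_mono hβ.le hwin (by exact_mod_cast (pow_grid_le (a := 19) (b := 10000) (by norm_num)).trans hNQ)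
  obtain ⟨𝒦, h𝒦, hreg, hsep, hcard⟩ := Hsc β hβ hβc (200 * Q) (999 * Q) (by omega) (by omega) hwin999
  obtain ⟨𝒦', h𝒦', hreg', hsep', hcard'⟩ := Hsc β hβ hβc (7 * Q) (19 * Q) (by omega) (by omega) hwin19
  -- sizes of `𝒦`, `𝒦'`
  have hQ₀a : 2 * (CK + 10) / (799 * cK) ≤ Q := by
    have h1 : (⌈2 * (CK + 10) / (799 * cK)⌉₊ : ℝ) ≤ Q := by exact_mod_cast le_trans (le_trans (le_max_left _ _) (le_max_left _ _)) hQ₀le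
    exact (Nat.le_ceil _).trans h1
  have hQ₀b : (CK + 10) / (6 * cK) ≤ Q := by
    have h1 : (⌈(CK + 10) / (6 * cK)⌉₊ : ℝ) ≤ Q := by exact_mod_cast le_trans (le_trans (le_max_right _ _) (le_max_left _ _)) hQ₀le
    exact (Nat.le_ceil _).trans h1
  have hQ₀c : 4 * C₀ ≤ Q := by
    have h1 : (⌈4 * C₀⌉₊ : ℝ) ≤ Q := by exact_mod_cast le_trans (le_max_right _ _) hQ₀le
    exact (Nat.le_ceil _).trans h1
  have hK10 : κ * Q + 10 ≤ #𝒦 := by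
    have h799 : ((999 * Q : ℕ) : ℝ) - (200 * Q : ℕ) = 799 * Q := by push_cast; ring
    rw [h799] at hcard
    have : 799 * cK * Q / 2 ≥ CK + 10 := by
      rw [div_le_iff₀ (by positivity)] at hQ₀a; linarith
    rw [hκ]; nlinarith
  have hK'10 : κ' * Q + 10 ≤ #𝒦' := by
    have h12 : ((19 * Q : ℕ) : ℝ) - (7 * Q : ℕ) = 12 * Q := by push_cast; ring
    rw [h12] at hcard'
    have : 6 * cK * Q ≥ CK + 10 := by
      rw [div_le_iff₀ (by positivity)] at hQ₀b; linarith
    rw [hκ']; nlinarith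
  have hcard10 : 10 ≤ #𝒦 := by
    have : (10 : ℝ) ≤ #𝒦 := by nlinarith [hK10, mul_nonneg hκ0.le hQ0.le]
    exact_mod_cast this
  have hcard10' : 10 ≤ #𝒦' := by
    have : (10 : ℝ) ≤ #𝒦' := by nlinarith [hK'10, mul_nonneg hκ'0.le hQ0.le]
    exact_mod_cast this
  -- the main estimate at scale `Q`
  have hmain := relocation_at_scale hβ hβc hCIR (HIR β hβ.le hβc) u xf zf y hc₀ hC₀ 𝒦 𝒦' hQ1 (by omega) hnQ hNQ hwin
    hxN hzN hyN h𝒦 hreg hsep hcard10 h𝒦' hreg' hsep' hcard10'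
  -- the error bound
  have hKE : 2 * (concErr c₀ C₀ 0 (1 / 4096) (1 / #𝒦) #𝒦 +
        splitErr CIR (1 / #𝒦) (Real.exp (-2) / (32 * criticalBeta 4) / (216 * (16 * ((2 ^ (1000 * Q) : ℕ) : ℝ)) ^ 3)) 1 n
          (2 ^ (100 * Q)) (2 ^ (200 * Q)) (2 ^ (200 * Q) - 1) (2 ^ (1000 * Q)) (2 ^ (3100 * Q)) (N - 1)) +
      2 * odErr c₀ C₀ CIR (1 / #𝒦') (Real.exp (-2) / (32 * criticalBeta 4) / (216 * (16 * ((2 ^ (20 * Q) : ℕ) : ℝ)) ^ 3))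
        (4 * C₀ * (2 ^ (20 * Q) : ℕ) / 2 ^ (200 * Q)) #𝒦' n (2 ^ (4 * Q)) (2 ^ (7 * Q)) (2 ^ (7 * Q) - 1)
        (2 ^ (20 * Q)) (2 ^ (64 * Q)) (2 ^ (196 * Q)) ≤ KE * (1 / Real.sqrt Q) := by
    have hisq : 0 ≤ 1 / Real.sqrt Q := by positivity
    -- top level
    have hη2 : (1 : ℝ) / #𝒦 ≤ 1 / 2 := one_div_le_one_div_of_le (by norm_num) (by exact_mod_cast (show 2 ≤ #𝒦 by omega))
    have hc1 : concErr c₀ C₀ 0 (1 / 4096) (1 / #𝒦) #𝒦 ≤ Real.sqrt (2 * A + A ^ 2) / Real.sqrt κ * (1 / Real.sqrt Q) := by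
      refine (concErr_le hc₀ hC₀.le le_rfl (by norm_num) hcard10).trans ?_
      rw [← hA, div_eq_mul_one_div]
      calc Real.sqrt (2 * A + A ^ 2) * (1 / Real.sqrt #𝒦) ≤ Real.sqrt (2 * A + A ^ 2) * (1 / Real.sqrt κ * (1 / Real.sqrt Q)) :=
            mul_le_mul_of_nonneg_left (inv_sqrt_le_of_ge hκ0 hQ1 (by linarith)) (Real.sqrt_nonneg _)
        _ = _ := by ring
    have hs1 : splitErr CIR (1 / #𝒦) (Real.exp (-2) / (32 * criticalBeta 4) / (216 * (16 * ((2 ^ (1000 * Q) : ℕ) : ℝ)) ^ 3)) 1 n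
        (2 ^ (100 * Q)) (2 ^ (200 * Q)) (2 ^ (200 * Q) - 1) (2 ^ (1000 * Q)) (2 ^ (3100 * Q)) (N - 1) ≤ KT * (1 / Real.sqrt Q) := by
      refine (splitErr_top_le hCIR hβc0 hη2 hQ1 (by omega) hnQ hNQ).trans ?_
      rw [← hKT, div_eq_mul_one_div]
      exact mul_le_mul_of_nonneg_left (inv_two_pow_le_inv_sqrt hQ1) (by rw [hKT]; positivity)
    -- lower level
    have hη2' : (1 : ℝ) / #𝒦' ≤ 1 / 2 := one_div_le_one_div_of_le (by norm_num) (by exact_mod_cast (show 2 ≤ #𝒦' by omega))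
    have hc2 : concErr c₀ C₀ (8 * C₀) (1 / 16) (1 / #𝒦') #𝒦' ≤ Real.sqrt (2 * A' + A' ^ 2) / Real.sqrt κ' * (1 / Real.sqrt Q) := by
      refine (concErr_le hc₀ hC₀.le (by positivity) (by norm_num) hcard10').trans ?_
      rw [← hA', div_eq_mul_one_div]
      calc Real.sqrt (2 * A' + A' ^ 2) * (1 / Real.sqrt #𝒦') ≤ Real.sqrt (2 * A' + A' ^ 2) * (1 / Real.sqrt κ' * (1 / Real.sqrt Q)) :=
            mul_le_mul_of_nonneg_left (inv_sqrt_le_of_ge hκ'0 hQ1 (by linarith)) (Real.sqrt_nonneg _)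
        _ = _ := by ring
    have hs2 : splitErr CIR (1 / #𝒦') (Real.exp (-2) / (32 * criticalBeta 4) / (216 * (16 * ((2 ^ (20 * Q) : ℕ) : ℝ)) ^ 3)) (1 + 4 * C₀) n
        (2 ^ (4 * Q)) (2 ^ (7 * Q)) (2 ^ (7 * Q) - 1) (2 ^ (20 * Q)) (2 ^ (64 * Q)) (2 ^ (196 * Q)) ≤ KL * (1 / Real.sqrt Q) := by
      refine (splitErr_low_le hCIR hβc0 hη2' hC₀.le hQ1 (by omega) hnQ).trans ?_
      rw [← hKL, div_eq_mul_one_div]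
      exact mul_le_mul_of_nonneg_left (inv_two_pow_le_inv_sqrt hQ1) (by rw [hKL]; positivity)
    have hζ : 4 * C₀ * ((2 ^ (20 * Q) : ℕ) : ℝ) / 2 ^ (200 * Q) ≤ 4 * C₀ * (1 / 2 ^ Q) := by
      rw [mul_one_div, div_le_div_iff₀ (by positivity) (by positivity)]
      have : ((2 ^ (20 * Q) : ℕ) : ℝ) * 2 ^ Q ≤ 2 ^ (200 * Q) := by
        have := two_pow_mul_le (a := 20) (b := 200) (Q := Q) (by norm_num)
        push_cast; exact this
      nlinarith [hC₀.le]
    have hζ1 : 4 * C₀ * ((2 ^ (20 * Q) : ℕ) : ℝ) / 2 ^ (200 * Q) ≤ 1 := by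
      refine hζ.trans ?_
      rw [mul_one_div, div_le_one (by positivity)]
      calc 4 * C₀ ≤ Q := hQ₀c
        _ ≤ 2 ^ Q := by exact_mod_cast (Nat.lt_two_pow_self (n := Q)).le
    have hζ0 : 0 ≤ 4 * C₀ * ((2 ^ (20 * Q) : ℕ) : ℝ) / 2 ^ (200 * Q) := by positivity
    have hη10' : (1 : ℝ) / #𝒦' ≤ 1 / 10 := one_div_le_one_div_of_le (by norm_num) (by exact_mod_cast hcard10')
    have hcl : (1 + 4 * C₀ * ((2 ^ (20 * Q) : ℕ) : ℝ) / 2 ^ (200 * Q)) ^ 4 / (1 - 1 / #𝒦') ^ 4 - 1 ≤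
        (128 * C₀ + 11 / κ') * (1 / Real.sqrt Q) := by
      refine (closeness_le hζ0 hζ1 (by positivity) hη10').trans ?_
      have h1 : (1 : ℝ) / #𝒦' ≤ 1 / κ' * (1 / Real.sqrt Q) := by
        calc (1 : ℝ) / #𝒦' ≤ 1 / (κ' * Q) := one_div_le_one_div_of_le (by positivity) (by linarith)
          _ = 1 / κ' * (1 / Q) := by rw [one_div_mul_one_div]
          _ ≤ 1 / κ' * (1 / Real.sqrt Q) := mul_le_mul_of_nonneg_left (inv_le_inv_sqrt hQ1) (by positivity)
      have h2 : (1 : ℝ) / 2 ^ Q ≤ 1 / Real.sqrt Q := inv_two_pow_le_inv_sqrt hQ1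
      calc 32 * (4 * C₀ * ((2 ^ (20 * Q) : ℕ) : ℝ) / 2 ^ (200 * Q)) + 11 * (1 / #𝒦')
          ≤ 32 * (4 * C₀ * (1 / Real.sqrt Q)) + 11 * (1 / κ' * (1 / Real.sqrt Q)) := by
            have := mul_le_mul_of_nonneg_left h2 (show (0:ℝ) ≤ 4 * C₀ by positivity)
            nlinarith [hζ, h1]
        _ = (128 * C₀ + 11 / κ') * (1 / Real.sqrt Q) := by ring
    unfold odErr
    rw [hKE]
    nlinarith [hc1, hs1, hc2, hs2, hcl, hisq]
  -- the rate
  have hrate : KE * (1 / Real.sqrt Q) ≤ Cfin * Real.log ((N : ℝ) / n) ^ (-(1 / 2 : ℝ)) := by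
    have h1 := inv_sqrt_le_rpow_log (D := 20000 * Real.log 2) (by have := Real.log_pos (show (1:ℝ) < 2 by norm_num); positivity)
      hlogpos hQ1 (by linarith [hlogQ])
    have hr0 : 0 ≤ Real.log ((N : ℝ) / n) ^ (-(1 / 2 : ℝ)) := Real.rpow_nonneg hlogpos.le _
    calc KE * (1 / Real.sqrt Q) ≤ |KE| * (1 / Real.sqrt Q) := mul_le_mul_of_nonneg_right (le_abs_self _) (by positivity)
      _ ≤ |KE| * (Real.sqrt (20000 * Real.log 2) * Real.log ((N : ℝ) / n) ^ (-(1 / 2 : ℝ))) :=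
          mul_le_mul_of_nonneg_left h1 (abs_nonneg _)
      _ ≤ Cfin * Real.log ((N : ℝ) / n) ^ (-(1 / 2 : ℝ)) := by rw [hCfin]; nlinarith [hr0, abs_nonneg KE]
  -- conclusion along the boxes
  filter_upwards [hmain] with L hL
  intro Φ hΦ1 hΦ
  by_cases hmem : (u ∈ box 4 L ∧ xf ∈ box 4 L ∧ zf ∈ box 4 L) ∧ y ∈ box 4 L
  · obtain ⟨⟨hu, hx, hz⟩, hy⟩ := hmem
    have hK : ∀ e, 0 ≤ Kc (box 4 L) β e := fun _ => hβ.le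
    rw [latEdgesWithin_eq hu] at hΦ
    have h := hL hu hx hz hy Φ hΦ1 hΦ
    have hle : Current.srcProb (Kc (box 4 L) β) ({⟨u, hu⟩} ∆ {⟨xf, hx⟩}) ({⟨u, hu⟩} ∆ {⟨zf, hz⟩}) Φ ≤
        Current.srcProb (Kc (box 4 L) β) ({⟨u, hu⟩} ∆ {⟨y, hy⟩}) ({⟨u, hu⟩} ∆ {⟨y, hy⟩}) Φ +
        Cfin * Real.log ((N : ℝ) / n) ^ (-(1 / 2 : ℝ)) := by
      have := (abs_sub_le_iff.1 h).1
      linarith [hKE, hrate]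
    by_cases hNA : Current.srcNrm (Kc (box 4 L) β) ({⟨u, hu⟩} ∆ {⟨xf, hx⟩}) ({⟨u, hu⟩} ∆ {⟨zf, hz⟩}) = 0
    · have hM0 : Current.srcMass (Kc (box 4 L) β) ({⟨u, hu⟩} ∆ {⟨xf, hx⟩}) ({⟨u, hu⟩} ∆ {⟨zf, hz⟩}) Φ = 0 :=
        le_antisymm (le_trans (Current.srcMass_le_srcNrm _ _ _ hΦ1) (le_of_eq hNA)) zero_le
      rw [finVolFourMass_eq_srcMass β hu hx hz, hM0, zero_mul]
      exact zero_le
    by_cases hNB : Current.srcNrm (Kc (box 4 L) β) ({⟨u, hu⟩} ∆ {⟨y, hy⟩}) ({⟨u, hu⟩} ∆ {⟨y, hy⟩}) = 0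
    · rw [finVolFourNrm_eq_srcNrm β hu hy hy, hNB, mul_zero]
      exact zero_le
    have hconv := Current.srcMass_mul_le_of_srcProb_le' hK hNA hNB hΦ1
      (by have := Real.rpow_nonneg hlogpos.le (-(1 / 2 : ℝ)); positivity) hle
    rw [finVolFourMass_eq_srcMass β hu hx hz, finVolFourMass_eq_srcMass β hu hy hy, finVolFourNrm_eq_srcNrm β hu hx hz,
      finVolFourNrm_eq_srcNrm β hu hy hy]
    exact hconv
  · -- some point off the box: a junk value `0` kills the left-hand side
    by_cases h1 : u ∈ box 4 L ∧ xf ∈ box 4 L ∧ zf ∈ box 4 L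
    · have hy : y ∉ box 4 L := fun hy => hmem ⟨h1, hy⟩
      have h0 : finVolFourNrm (box 4 L) β u y y = 0 := by
        unfold finVolFourNrm
        rw [dif_neg (fun h => hy h.2.1)]
      rw [h0, mul_zero]
      exact zero_le
    · have h0 : finVolFourMass (box 4 L) β u xf zf Φ = 0 := by
        unfold finVolFourMass
        rw [dif_neg h1]
      rw [h0, zero_mul]
      exact zero_le

end Current

end Literature.Probability.LatticeModels
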